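import Literature.NumberTheory.LFunctions.Zhang2022.Section3Lemma31
import Literature.NumberTheory.LFunctions.ExceptionalZeroLogDerivOne
import Literature.Analysis.Complex.VerticalLineShiftPoles
import HarnessLib

/-!
# Zhang (2022), Lemma 17.1 (Appendix B): `∑_{n < D⁴} ν(n)²/n = 𝔞 + o(1)` under (A), kernel-checked

Topic `Literature/NumberTheory/LFunctions/Zhang2022` (Landau–Siegel autopsy tree; verdict-neutral).
Y. Zhang, *Discrete mean estimates and the Landau–Siegel zero*, arXiv:2211.02515v1 (2022) — **an
unrefereed manuscript, a claimed result under adjudication** — §17, Lemma 17.1 (p. 35: "Lemma 17.1.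
We have `∑_{n<D⁴} ν(n)²/n = 𝔞 + o(1)`"), with `ν(n) = ∑_{d∣n} χ(d)` (`χ` the real primitive character
mod `D`, `𝓛 = log D`) and the normalising constant of (2.31),

  `𝔞 = (6/π²) L′(1,χ)² ∏_{q∣D} q/(q+1)`,

in which all the main terms of §§8–18 of the source are measured (Propositions 2.4–2.6). The printed
proof (Appendix B, p. 39) inserts the Gaussian weight `g(T/n)` at the cost `o(1)` "by Lemma 3.1",
writes `∑ ν(n)² n^{-s} = ζ(s)²L(s,χ)² ∏_{(p,D)=1}(1−p^{-2s}) ∏_{p∣D}(1−p^{-s})` (three Euler-factor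
cases, "see [19, (1.2.10)]"), and takes "the residue … at `s = 0`, plus an acceptable error", "which is
equal to `L′(1,χ)² ∏_p(1−p^{-2}) ∏_{p∣D}(1−p^{-1})(1−p^{-2})^{-1} + o(1) = 𝔞 + o(1)`" — the lower-order
terms of the triple pole being `o(1)` because each carries a factor `L(1,χ)`, small under the
standing assumption (A) `L(1,χ) ≤ 𝓛^{-2022}` of the source (the lemma is used only under (A)).

This file PROVES the lemma with an explicit rate and threshold (`lemma_17_1`): there is an absolute
`C` with

  `|∑_{n<D⁴} |ν(n)|²/n − 𝔞| ≤ C 𝓛^{-2011}`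

for every `D` with `log D ≥ 3` and every primitive quadratic `χ` mod `D` satisfying (A)
`‖L(1,χ)‖ ≤ 𝓛^{-2022}`. The architecture is the printed one, on the machine already used for the
tree's Lemma 3.1 (`Section3Lemma31.lean`) and Lemma 3.2♭ (`Section3Lemma32Flat.lean`):

1. *Smoothing* (§3 below; the source's "By Lemma 3.1, `∑_{n<D⁴} ν(n)²/n = ∑_n ν(n)²/n g(T/n) + o(1)`"),
   with the weight `e^{-n/X}`, `X = D⁶`, in place of the Gaussian `g`: the ranges `n < D⁴`
   (`1 − e^{-n/X} ≤ n/X`, divisor bound) and `n > D⁸` (`e^{-n/X} ≤ e^{-D²/2} e^{-n/(2X)}`) cost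
   `O(D^{-1/2})`, and `D⁴ ≤ n ≤ D⁸` costs `O(𝓛^{-2011})` by the tree's **Lemma 3.1**
   (`Lemma31.lemma_3_1`) — this is the step that uses (A).
2. *Mellin and the Dirichlet series* (§2): `∑ ν² n^{-1-z} = ζ(1+z)² L(1+z,χ)² φ(1+z)` with Zhang's
   `φ` in closed form (`DivisorSumCharSq.phi`, `…LSeries_divisorSumChar_sq_one_add`; the Euler-factor
   computation is the tree's `RamanujanDivisorSquare.lean`), so `W(X) = ∑ ν(n)²e^{-n/X}/n
   = (1/2πi)∫_{(2)} ζ(1+z)²Γ(z)X^z L(1+z,χ)²φ(1+z) dz`.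
3. *Shift to `re z = −1/4`* across the pole of ORDER THREE at `z = 0` (§§4–5), by the tree's strip
   theorem `Literature.Analysis.Complex.integral_vertical_sub_eq_sum_of_poles_dslope`; on the new
   line the Pólya–Vinogradov-strength bound of `Lemma31.norm_gFun_line_le` gives
   `O(d(D)² D^{1/4} (1+𝓛)³ X^{-1/4}) = O(D^{-1/2})`.
4. *The residue* (§6): writing `L(1+z,χ) = L(1,χ) + z k(z)` the regularised numerator splits as
   `h = L(1,χ)² a + 2L(1,χ) z·ak + z²·ak²`, so the residue is `a(0)k(0)² + 2L(1,χ)(ak)′(0)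
   + L(1,χ)² (dslope a 0)′(0)`; the first term is `φ(1) L′(1,χ)² = 𝔞` EXACTLY (§7:
   `φ(1) = (ζ(2)∏_{p∣D}(1+p^{-1}))^{-1} = (6/π²)∏_{p∣D} p/(p+1)`, Mathlib's `riemannZeta_two`), and the
   other two are `O(𝓛^{-2019})` by Cauchy's estimate on `|z| = 1/(4𝓛)` and (A).

Only definitions of the manuscript are used; nothing about its Theorems 1–2 is stated or implied,
and the cell's verdict (the located failure of (8.24)) is independent of this lemma (STEPS row
XB.17.1, "shown" by hand; this file makes it kernel-checked).

## References

* Y. Zhang, arXiv:2211.02515v1 (2022), §2 (2.31), §17 Lemma 17.1, Appendix B "Proof of Lemma 17.1".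
  [cite: Zhang2022LandauSiegel, §17, Lemma 17.1; App. B]
* E. C. Titchmarsh, *The Theory of the Riemann Zeta-Function*, 2nd ed. (1986), (1.2.10). [Titchmarsh1986]
-/

noncomputable section

open Complex Filter Topology Set MeasureTheory Real Metric
open scoped LSeries.notation

namespace Literature.NumberTheory.LFunctions.Zhang2022.Lemma171

open Literature.NumberTheory.LFunctions.DivisorSumCharSq (phi phi_def differentiableAt_phi gFun
  gFun_def LSeries_divisorSumChar_sq_one_add differentiableOn_gFun W W_eq_tsum
  integral_Gamma_cpow_LSeries_eq integrable_Gamma_cpow_LSeries exists_norm_divisorSumChar_sq_le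
  rpow_le_rpow_add Zconst Zconst_nonneg norm_gFun_le phiBound phiBound_pos)
open Literature.NumberTheory.LFunctions.Zhang2022.Lemma31 (W_ofReal summable_mul_exp_div
  norm_LFunction_le_near_one norm_deriv_LFunction_le_near_one norm_LFunction_one_add_sub_le
  ne_one_of_isPrimitive divisorSumChar_im_eq_zero divisorSumChar_sq_eq W_nuSq_eq summable_nuSq
  norm_phi_one_add_le norm_gFun_line_le eight_lt_exp_three aux_logpow)
open Literature.NumberTheory.LFunctions.ZetaM4 (CΓ CΓ_pos norm_Gamma_strip_le pow_mul_exp_le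
  integrable_pow_mul_exp integral_pow_mul_exp_le exists_pow_mul_exp_le)

variable {D : ℕ} [NeZero D] (χ : DirichletCharacter ℂ D)

/-! ### §1. The objects -/

/-- **(2.31)** `𝔞 = (6/π²) L′(1,χ)² ∏_{q∣D} q/(q+1)`, the normalising constant of the source
(`L′(1,χ)` is real for a quadratic `χ`, `deriv_LFunction_one_im`).
[cite: Zhang2022LandauSiegel, §2 (2.31)] -/
def frakA : ℝ :=
  6 / π ^ 2 * (deriv χ.LFunction 1).re ^ 2 * ∏ p ∈ D.primeFactors, ((p : ℝ) / (p + 1))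

/-- Unfolding lemma for `frakA`. [cite: Zhang2022LandauSiegel, §2 (2.31)] -/
theorem frakA_def : frakA χ =
    6 / π ^ 2 * (deriv χ.LFunction 1).re ^ 2 * ∏ p ∈ D.primeFactors, ((p : ℝ) / (p + 1)) := rfl

/-- The complex form `(6/π²) L′(1,χ)² ∏_{q∣D} q/(q+1)` of `𝔞`. [cite: Zhang2022LandauSiegel, §2 (2.31)] -/
def frakAC : ℂ :=
  6 / (π : ℂ) ^ 2 * deriv χ.LFunction 1 ^ 2 * ∏ p ∈ D.primeFactors, ((p : ℂ) / (p + 1))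

variable (X : ℝ)

/-- `u(z) = ζ₁(1+z)² Γ(z+1) X^z` (`ζ₁(w) = (w−1)ζ(w)`, Mathlib's `riemannZeta₁`). [folklore] -/
def uF (z : ℂ) : ℂ := riemannZeta₁ (1 + z) ^ 2 * Complex.Gamma (z + 1) * (X : ℂ) ^ z

/-- `a(z) = u(z) φ(1+z)` (`φ = φ_N` of `DivisorSumCharSq.phi`, level `N`). [folklore] -/
def aF (N : ℕ) (X : ℝ) (z : ℂ) : ℂ := uF X z * phi N (1 + z)

/-- `k(z) = (L(1+z,χ) − L(1,χ))/z`, extended by `k(0) = L′(1,χ)` (Mathlib's `dslope`). [folklore] -/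
def kF : ℂ → ℂ := dslope (fun z : ℂ => χ.LFunction (1 + z)) 0

/-- The regularised numerator `h(z) = ζ₁(1+z)² Γ(z+1) X^z · L(1+z,χ)² φ(1+z)` (holomorphic on
`re z > −1/2`). [folklore] -/
def hnum (z : ℂ) : ℂ := uF X z * gFun χ z

/-- The integrand `F(z) = ζ(1+z)² Γ(z) X^z L(1+z,χ)² φ(1+z)`.
[cite: Zhang2022LandauSiegel, App. B, proof of Lemma 17.1] -/
def Fint (z : ℂ) : ℂ :=
  riemannZeta (1 + z) ^ 2 * Complex.Gamma z * (X : ℂ) ^ z * gFun χ z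

variable {X}

/-- `L(1+z,χ) = L(1,χ) + z k(z)`. [folklore] -/
theorem LFunction_one_add_eq (z : ℂ) : χ.LFunction (1 + z) = χ.LFunction 1 + z * kF χ z := by
  have h := sub_smul_dslope (fun z : ℂ => χ.LFunction (1 + z)) 0 z
  simp only [sub_zero, smul_eq_mul, add_zero] at h
  rw [kF]
  linear_combination -h

/-- `k(0) = L′(1,χ)`. [folklore] -/
theorem kF_zero : kF χ 0 = deriv χ.LFunction 1 := by
  rw [kF, dslope_same]
  have := deriv_comp_const_add (f := χ.LFunction) (a := (1 : ℂ)) (x := 0)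
  simpa using this

/-- `u(0) = 1`. [folklore] -/
theorem uF_zero : uF X 0 = 1 := by
  simp [uF, riemannZeta₁_one, Complex.Gamma_one, cpow_zero]

/-- **The splitting of the numerator**:
`h(z) = L(1,χ)² a(z) + 2L(1,χ)·z·(a k)(z) + z²·(a k²)(z)`. [folklore] -/
theorem hnum_eq (z : ℂ) : hnum χ X z =
    χ.LFunction 1 ^ 2 * aF D X z + 2 * χ.LFunction 1 * (z * (aF D X z * kF χ z)) +
      z ^ 2 * (aF D X z * kF χ z ^ 2) := by
  rw [hnum, gFun_def, LFunction_one_add_eq χ z, aF]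
  ring

/-- Off `z = 0` (and off the poles of `Γ`), `F(z) = h(z)/z³`. [folklore] -/
theorem Fint_eq_hnum_div {z : ℂ} (hz : z ≠ 0) (hz' : ∀ m : ℕ, z ≠ -(m : ℂ)) :
    Fint χ X z = hnum χ X z / (z - 0) ^ (2 + 1) := by
  have h1 : (1 : ℂ) + z ≠ 1 := by intro h; exact hz (by linear_combination h)
  rw [Fint, hnum, uF, LFunctions.riemannZeta₁_eq_mul h1, Complex.Gamma_add_one _ hz,
    sub_zero, add_sub_cancel_left]
  have := hz' 0
  field_simp
  ring

/-- `∑ ν(n)² n^{-(1+z)} = ζ(1+z)² g(z)`, so on `re z > 0`,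
`F(z) = Γ(z) X^z L(ν², 1+z)`. [cite: Zhang2022LandauSiegel, App. B, proof of Lemma 17.1] -/
theorem Fint_eq_of_pos (hχ : χ ^ 2 = 1) {z : ℂ} (hz : 0 < z.re) :
    Fint χ X z = Complex.Gamma z * (X : ℂ) ^ z * L (fun n => divisorSumChar χ n ^ 2) (1 + z) := by
  rw [Fint, LSeries_divisorSumChar_sq_one_add χ hχ hz]
  ring

/-- The open half-plane `U = {re z > −1/2}` on which everything is holomorphic. [folklore] -/
theorem isOpen_U : IsOpen {z : ℂ | -(1 / 2) < z.re} := isOpen_lt continuous_const Complex.continuous_re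

/-- `u` is differentiable on `re z > −1/2` (for `X > 0`). [folklore] -/
theorem differentiableOn_uF (hX : 0 < X) : DifferentiableOn ℂ (uF X) {z : ℂ | -(1 / 2) < z.re} := by
  intro z hz
  have hz' : -(1 / 2) < z.re := hz
  refine DifferentiableAt.differentiableWithinAt ?_
  refine DifferentiableAt.mul (DifferentiableAt.mul ?_ ?_) ?_
  · exact ((differentiable_riemannZeta₁.comp
      ((differentiable_const (1 : ℂ)).add differentiable_id)) z).pow 2
  · refine (Complex.differentiableAt_Gamma _ fun m hm => ?_).comp z (differentiableAt_id.add_const 1)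
    have := congrArg Complex.re hm
    simp at this
    have h0 : (0 : ℝ) ≤ m := Nat.cast_nonneg m
    linarith
  · exact differentiableAt_id.const_cpow (Or.inl (ofReal_ne_zero.2 hX.ne'))

/-- `a` is differentiable on `re z > −1/2`. [folklore] -/
theorem differentiableOn_aF {N : ℕ} (hX : 0 < X) :
    DifferentiableOn ℂ (aF N X) {z : ℂ | -(1 / 2) < z.re} := by
  intro z hz
  have hz' : -(1 / 2) < z.re := hz
  refine (differentiableOn_uF hX z hz).mul (DifferentiableAt.differentiableWithinAt ?_)
  have h1 : DifferentiableAt ℂ (fun z : ℂ => (1 : ℂ) + z) z := differentiableAt_id.const_add _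
  exact (differentiableAt_phi N (w := 1 + z) (by simp; linarith)).comp z h1

/-- `k` is entire (`χ ≠ 1`). [folklore] -/
theorem differentiable_kF (hχ1 : χ ≠ 1) : Differentiable ℂ (kF χ) := by
  have hL : Differentiable ℂ (fun z : ℂ => χ.LFunction (1 + z)) :=
    (DirichletCharacter.differentiable_LFunction hχ1).comp ((differentiable_const _).add differentiable_id)
  intro z
  rcases eq_or_ne z 0 with rfl | hz
  · obtain ⟨p, hp⟩ := hL.analyticAt 0
    exact (hp.has_fpower_series_dslope_fslope.analyticAt).differentiableAt
  · exact (differentiableAt_dslope_of_ne hz).2 (hL z)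

/-- `h` is differentiable on `re z > −1/2` (`χ ≠ 1`). [folklore] -/
theorem differentiableOn_hnum (hχ1 : χ ≠ 1) (hX : 0 < X) :
    DifferentiableOn ℂ (hnum χ X) {z : ℂ | -(1 / 2) < z.re} := fun z hz =>
  (differentiableOn_uF hX z hz).mul (differentiableOn_gFun χ hχ1 z hz)

/-- `F` is differentiable on `re z > −1/2` away from `z = 0`. [folklore] -/
theorem differentiableOn_Fint (hχ1 : χ ≠ 1) (hX : 0 < X) :
    DifferentiableOn ℂ (Fint χ X) ({z : ℂ | -(1 / 2) < z.re} \ {0}) := by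
  intro z hz
  have hz1 : -(1 / 2) < z.re := hz.1
  have hz0 : z ≠ 0 := hz.2
  refine DifferentiableWithinAt.mul ?_ ((differentiableOn_gFun χ hχ1 z hz.1).mono fun x hx => hx.1)
  refine DifferentiableAt.differentiableWithinAt ?_
  refine DifferentiableAt.mul (DifferentiableAt.mul ?_ ?_) ?_
  · have h1 : (1 : ℂ) + z ≠ 1 := by intro h; exact hz0 (by linear_combination h)
    exact ((differentiableAt_riemannZeta h1).comp z (differentiableAt_id.const_add _)).pow 2
  · refine Complex.differentiableAt_Gamma _ fun m hm => ?_
    rcases Nat.eq_zero_or_pos m with rfl | hm0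
    · exact hz0 (by simpa using hm)
    · have := congrArg Complex.re hm
      simp at this
      have h1 : (1 : ℝ) ≤ m := by exact_mod_cast hm0
      linarith
  · exact differentiableAt_id.const_cpow (Or.inl (ofReal_ne_zero.2 hX.ne'))

/-! ### §2. The line `re z = 2`: Mellin -/

/-- **Mellin on `re z = 2`**: integrability and `∫ F(2+iy) dy = 2π W_{ν²}(X)`,
`W_{ν²}(X) = ∑ ν(n)² e^{-n/X}/n`. [cite: Zhang2022LandauSiegel, App. B, proof of Lemma 17.1] -/
theorem integral_Fint_line_two (hχ : χ ^ 2 = 1) (hX : 0 < X) :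
    Integrable (fun y : ℝ => Fint χ X (2 + y * I)) ∧
    ∫ y : ℝ, Fint χ X (2 + y * I) = 2 * π * W (fun n => divisorSumChar χ n ^ 2) X := by
  obtain ⟨C, hC⟩ := exists_norm_divisorSumChar_sq_le χ
  have I₁ := integrable_Gamma_cpow_LSeries hC hX
  have hfun : (fun y : ℝ => Fint χ X (2 + y * I)) = fun y : ℝ =>
      Complex.Gamma (2 + y * I) * (X : ℂ) ^ (2 + y * I : ℂ) *
        L (fun n => divisorSumChar χ n ^ 2) (1 + (2 + y * I)) :=
    funext fun y => Fint_eq_of_pos χ hχ (by simp)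
  rw [hfun]
  exact ⟨I₁, integral_Gamma_cpow_LSeries_eq hC hX⟩

/-! ### §3. The smoothing step: `∑_{n<D⁴} |ν(n)|²/n` against `W_{ν²}(D⁶)` -/

section Smoothing

omit [NeZero D]

/-- `|ν(n)|² ≤ C_d² n^{1/4}` from the divisor bound `d(n) ≤ C_d n^{1/8}`. [folklore] -/
theorem norm_nu_sq_le {Cd : ℝ} (hCd : ∀ n : ℕ, (n.divisors.card : ℝ) ≤ Cd * (n : ℝ) ^ (1 / 8 : ℝ))
    (n : ℕ) : ‖divisorSumChar χ n‖ ^ 2 ≤ Cd ^ 2 * (n : ℝ) ^ (1 / 4 : ℝ) := by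
  have h1 := (norm_divisorSumChar_le χ n).trans (hCd n)
  have h0 : 0 ≤ ‖divisorSumChar χ n‖ := norm_nonneg _
  calc ‖divisorSumChar χ n‖ ^ 2 ≤ (Cd * (n : ℝ) ^ (1 / 8 : ℝ)) ^ 2 := pow_le_pow_left₀ h0 h1 2
    _ = Cd ^ 2 * ((n : ℝ) ^ (1 / 8 : ℝ)) ^ 2 := by ring
    _ = Cd ^ 2 * (n : ℝ) ^ (1 / 4 : ℝ) := by
        rw [← Real.rpow_natCast ((n : ℝ) ^ (1 / 8 : ℝ)) 2, ← Real.rpow_mul (Nat.cast_nonneg n)]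
        norm_num

/-- `(1 − e^{-n/X})/n ≤ 1/X` (`1 − e^{-t} ≤ t`). [folklore] -/
theorem one_sub_exp_div_le {X : ℝ} (hX : 0 < X) (n : ℕ) :
    (1 - Real.exp (-(n / X))) / n ≤ 1 / X := by
  rcases Nat.eq_zero_or_pos n with rfl | hn
  · simp; exact hX.le
  have hn' : (0 : ℝ) < n := by exact_mod_cast hn
  have h1 := Real.add_one_le_exp (-((n : ℝ) / X))
  rw [div_le_div_iff₀ hn' hX]
  calc (1 - Real.exp (-(n / X))) * X ≤ ((n : ℝ) / X) * X := by
        refine mul_le_mul_of_nonneg_right ?_ hX.le; linarith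
    _ = 1 * n := by field_simp

/-- **The head `n < D⁴`**: `0 ≤ ∑_{n<D⁴} |ν(n)|²/n − ∑_{n<D⁴} |ν(n)|² e^{-n/X}/n ≤ C_d² D⁵/X`.
[cite: Zhang2022LandauSiegel, App. B, proof of Lemma 17.1] -/
theorem head_sub_le {Cd : ℝ} (hCd : ∀ n : ℕ, (n.divisors.card : ℝ) ≤ Cd * (n : ℝ) ^ (1 / 8 : ℝ))
    {X : ℝ} (hX : 0 < X) :
    0 ≤ ∑ n ∈ Finset.range (D ^ 4), ‖divisorSumChar χ n‖ ^ 2 / n -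
        ∑ n ∈ Finset.range (D ^ 4), ‖divisorSumChar χ n‖ ^ 2 * Real.exp (-(n / X)) / n ∧
      ∑ n ∈ Finset.range (D ^ 4), ‖divisorSumChar χ n‖ ^ 2 / n -
        ∑ n ∈ Finset.range (D ^ 4), ‖divisorSumChar χ n‖ ^ 2 * Real.exp (-(n / X)) / n ≤
        Cd ^ 2 * (D : ℝ) ^ 5 / X := by
  rw [← Finset.sum_sub_distrib]
  have hterm : ∀ n ∈ Finset.range (D ^ 4),
      0 ≤ ‖divisorSumChar χ n‖ ^ 2 / n - ‖divisorSumChar χ n‖ ^ 2 * Real.exp (-(n / X)) / n ∧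
      ‖divisorSumChar χ n‖ ^ 2 / n - ‖divisorSumChar χ n‖ ^ 2 * Real.exp (-(n / X)) / n ≤
        Cd ^ 2 * D / X := by
    intro n hn
    rw [Finset.mem_range] at hn
    have e : ‖divisorSumChar χ n‖ ^ 2 / n - ‖divisorSumChar χ n‖ ^ 2 * Real.exp (-(n / X)) / n =
        ‖divisorSumChar χ n‖ ^ 2 * ((1 - Real.exp (-(n / X))) / n) := by ring
    rw [e]
    have h1 : Real.exp (-(n / X)) ≤ 1 := by
      rw [Real.exp_le_one_iff]; have : (0 : ℝ) ≤ n / X := by positivity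
      linarith
    refine ⟨mul_nonneg (sq_nonneg _) (div_nonneg (by linarith) (Nat.cast_nonneg n)), ?_⟩
    have hν := norm_nu_sq_le χ hCd n
    have hn4 : (n : ℝ) ^ (1 / 4 : ℝ) ≤ D := by
      have hnD : (n : ℝ) ≤ (D : ℝ) ^ 4 := by exact_mod_cast hn.le
      calc (n : ℝ) ^ (1 / 4 : ℝ) ≤ ((D : ℝ) ^ 4) ^ (1 / 4 : ℝ) :=
            Real.rpow_le_rpow (Nat.cast_nonneg n) hnD (by norm_num)
        _ = D := by
            rw [← Real.rpow_natCast, ← Real.rpow_mul (Nat.cast_nonneg D)]; norm_num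
    calc ‖divisorSumChar χ n‖ ^ 2 * ((1 - Real.exp (-(n / X))) / n)
        ≤ (Cd ^ 2 * (n : ℝ) ^ (1 / 4 : ℝ)) * (1 / X) :=
          mul_le_mul hν (one_sub_exp_div_le hX n) (div_nonneg (by linarith) (Nat.cast_nonneg n))
            (by positivity)
      _ ≤ (Cd ^ 2 * D) * (1 / X) := by gcongr
      _ = Cd ^ 2 * D / X := by ring
  refine ⟨Finset.sum_nonneg fun n hn => (hterm n hn).1, ?_⟩
  calc ∑ n ∈ Finset.range (D ^ 4),
        (‖divisorSumChar χ n‖ ^ 2 / n - ‖divisorSumChar χ n‖ ^ 2 * Real.exp (-(n / X)) / n)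
      ≤ ∑ n ∈ Finset.range (D ^ 4), Cd ^ 2 * D / X := Finset.sum_le_sum fun n hn => (hterm n hn).2
    _ = (D : ℝ) ^ 4 * (Cd ^ 2 * D / X) := by
        rw [Finset.sum_const, Finset.card_range, nsmul_eq_mul]; push_cast; ring
    _ = Cd ^ 2 * (D : ℝ) ^ 5 / X := by ring

/-- The geometric series `∑_{n ≥ 0} e^{-n/Y} = (1 − e^{-1/Y})^{-1} ≤ Y + 1` (`Y > 0`). [folklore] -/
theorem hasSum_exp_neg_div {Y : ℝ} (hY : 0 < Y) :
    HasSum (fun n : ℕ => Real.exp (-(n / Y))) (1 - Real.exp (-(1 / Y)))⁻¹ ∧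
      (1 - Real.exp (-(1 / Y)))⁻¹ ≤ Y + 1 := by
  set r : ℝ := Real.exp (-(1 / Y)) with hr
  have hr0 : 0 ≤ r := (Real.exp_pos _).le
  have hr1 : r < 1 := by
    rw [hr]; refine Real.exp_lt_one_iff.2 ?_; have := one_div_pos.2 hY; linarith
  have hgeom := hasSum_geometric_of_lt_one hr0 hr1
  have hfun : (fun n : ℕ => Real.exp (-(n / Y))) = fun n : ℕ => r ^ n := by
    funext n
    rw [hr, ← Real.exp_nat_mul]
    congr 1; ring
  rw [hfun]
  refine ⟨hgeom, ?_⟩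
  have hY1 : 0 < Y + 1 := by linarith
  have hlow : 1 / (Y + 1) ≤ 1 - r := by
    have h1 : 1 + 1 / Y ≤ Real.exp (1 / Y) := by
      have := Real.add_one_le_exp (1 / Y); linarith
    have hE : 0 < Real.exp (1 / Y) := Real.exp_pos _
    have h2 : r * Real.exp (1 / Y) = 1 := by
      rw [hr, ← Real.exp_add]; norm_num
    have h3 : r ≤ Y / (Y + 1) := by
      have er : r = 1 / Real.exp (1 / Y) := by
        field_simp; linarith [h2]
      rw [er, div_le_div_iff₀ hE hY1]
      calc 1 * (Y + 1) = (1 + 1 / Y) * Y := by field_simp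
        _ ≤ Real.exp (1 / Y) * Y := by gcongr
        _ = Y * Real.exp (1 / Y) := by ring
    have e1 : 1 / (Y + 1) = 1 - Y / (Y + 1) := by field_simp; ring
    rw [e1]; linarith
  calc (1 - r)⁻¹ ≤ (1 / (Y + 1))⁻¹ := inv_anti₀ (by positivity) hlow
    _ = Y + 1 := by rw [one_div, inv_inv]

/-- `e^{-D²/2} ≤ 384/D⁸` (`x⁴/4! ≤ eˣ` at `x = D²/2`). [folklore] -/
theorem exp_neg_sq_half_le (hD : 0 < (D : ℝ)) :
    Real.exp (-((D : ℝ) ^ 2 / 2)) ≤ 384 / (D : ℝ) ^ 8 := by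
  have h := Real.pow_div_factorial_le_exp ((D : ℝ) ^ 2 / 2) (by positivity) 4
  have hfac : ((Nat.factorial 4 : ℕ) : ℝ) = 24 := by norm_num [Nat.factorial]
  rw [hfac] at h
  have hE : 0 < Real.exp ((D : ℝ) ^ 2 / 2) := Real.exp_pos _
  have hD8 : 0 < (D : ℝ) ^ 8 := by positivity
  rw [Real.exp_neg, inv_eq_one_div, div_le_div_iff₀ hE hD8]
  have e : ((D : ℝ) ^ 2 / 2) ^ 4 / 24 = (D : ℝ) ^ 8 / 384 := by ring
  rw [e] at h
  have := (div_le_iff₀ (by norm_num : (0 : ℝ) < 384)).1 h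
  linarith

/-- The real series `|ν(n)|² e^{-n/Y}/n` sums to at most `C_d² (Y + 1)` (termwise
`≤ C_d² e^{-n/Y}`). [folklore] -/
theorem tsum_nuSq_le {Cd : ℝ} (hCd : ∀ n : ℕ, (n.divisors.card : ℝ) ≤ Cd * (n : ℝ) ^ (1 / 8 : ℝ))
    {Y : ℝ} (hY : 0 < Y) :
    ∑' n : ℕ, ‖divisorSumChar χ n‖ ^ 2 * Real.exp (-(n / Y)) / n ≤ Cd ^ 2 * (Y + 1) := by
  obtain ⟨hgeom, hbound⟩ := hasSum_exp_neg_div hY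
  have hterm : ∀ n : ℕ, ‖divisorSumChar χ n‖ ^ 2 * Real.exp (-(n / Y)) / n ≤
      Cd ^ 2 * Real.exp (-(n / Y)) := by
    intro n
    rcases Nat.eq_zero_or_pos n with rfl | hn
    · simp; positivity
    have hn' : (0 : ℝ) < n := by exact_mod_cast hn
    have hn1 : (1 : ℝ) ≤ n := by exact_mod_cast hn
    have hν := norm_nu_sq_le χ hCd n
    have h14 : (n : ℝ) ^ (1 / 4 : ℝ) ≤ n := by
      calc (n : ℝ) ^ (1 / 4 : ℝ) ≤ (n : ℝ) ^ (1 : ℝ) :=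
            Real.rpow_le_rpow_of_exponent_le hn1 (by norm_num)
        _ = n := Real.rpow_one _
    rw [div_le_iff₀ hn']
    have hE := Real.exp_pos (-((n : ℝ) / Y))
    calc ‖divisorSumChar χ n‖ ^ 2 * Real.exp (-(n / Y))
        ≤ (Cd ^ 2 * (n : ℝ) ^ (1 / 4 : ℝ)) * Real.exp (-(n / Y)) := by gcongr
      _ ≤ (Cd ^ 2 * n) * Real.exp (-(n / Y)) := by gcongr
      _ = Cd ^ 2 * Real.exp (-(n / Y)) * n := by ring
  calc ∑' n : ℕ, ‖divisorSumChar χ n‖ ^ 2 * Real.exp (-(n / Y)) / n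
      ≤ ∑' n : ℕ, Cd ^ 2 * Real.exp (-(n / Y)) :=
        Summable.tsum_le_tsum hterm (summable_nuSq χ hY) (hgeom.summable.mul_left _)
    _ = Cd ^ 2 * (1 - Real.exp (-(1 / Y)))⁻¹ := by rw [tsum_mul_left, hgeom.tsum_eq]
    _ ≤ Cd ^ 2 * (Y + 1) := by gcongr

end Smoothing

section Smoothing2

omit [NeZero D]

/-- Far-tail terms: for `n ≥ D⁸ + 1`,
`|ν(n)|² e^{-n/D⁶}/n ≤ (384/D⁸) · |ν(n)|² e^{-n/(2D⁶)}/n` (`e^{-n/(2D⁶)} ≤ e^{-D²/2} ≤ 384/D⁸`).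
[folklore] -/
theorem far_term_le (hD : 0 < (D : ℝ)) {n : ℕ} (hn : D ^ 8 + 1 ≤ n) :
    ‖divisorSumChar χ n‖ ^ 2 * Real.exp (-(n / (D : ℝ) ^ 6)) / n ≤
      384 / (D : ℝ) ^ 8 *
        (‖divisorSumChar χ n‖ ^ 2 * Real.exp (-(n / (2 * (D : ℝ) ^ 6))) / n) := by
  have hY : 0 < (D : ℝ) ^ 6 := by positivity
  have hn' : (D : ℝ) ^ 8 ≤ n := by
    have : ((D ^ 8 + 1 : ℕ) : ℝ) ≤ n := by exact_mod_cast hn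
    push_cast at this; linarith
  have hsplit : Real.exp (-(n / (D : ℝ) ^ 6)) =
      Real.exp (-(n / (2 * (D : ℝ) ^ 6))) * Real.exp (-(n / (2 * (D : ℝ) ^ 6))) := by
    rw [← Real.exp_add]; congr 1; field_simp; ring
  have hsmall : Real.exp (-(n / (2 * (D : ℝ) ^ 6))) ≤ 384 / (D : ℝ) ^ 8 := by
    refine le_trans ?_ (exp_neg_sq_half_le hD)
    rw [Real.exp_le_exp, neg_le_neg_iff, le_div_iff₀ (by positivity)]
    have e : (D : ℝ) ^ 2 / 2 * (2 * (D : ℝ) ^ 6) = (D : ℝ) ^ 8 := by ring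
    rw [e]; exact hn'
  have h0 : 0 ≤ ‖divisorSumChar χ n‖ ^ 2 * Real.exp (-(n / (2 * (D : ℝ) ^ 6))) / n := by positivity
  rw [hsplit]
  calc ‖divisorSumChar χ n‖ ^ 2 *
        (Real.exp (-(n / (2 * (D : ℝ) ^ 6))) * Real.exp (-(n / (2 * (D : ℝ) ^ 6)))) / n
      = Real.exp (-(n / (2 * (D : ℝ) ^ 6))) *
          (‖divisorSumChar χ n‖ ^ 2 * Real.exp (-(n / (2 * (D : ℝ) ^ 6))) / n) := by ring
    _ ≤ 384 / (D : ℝ) ^ 8 *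
          (‖divisorSumChar χ n‖ ^ 2 * Real.exp (-(n / (2 * (D : ℝ) ^ 6))) / n) :=
        mul_le_mul_of_nonneg_right hsmall h0

/-- **The tail `n ≥ D⁴`** of `a(n) = |ν(n)|² e^{-n/D⁶}/n`:
`0 ≤ ∑_m a(m + D⁴) ≤ ∑_{D⁴ ≤ n ≤ D⁸} |ν(n)|²/n + (384/D⁸) C_d² (2D⁶ + 1)`.
[cite: Zhang2022LandauSiegel, App. B, proof of Lemma 17.1] -/
theorem tail_le {Cd : ℝ} (hCd : ∀ n : ℕ, (n.divisors.card : ℝ) ≤ Cd * (n : ℝ) ^ (1 / 8 : ℝ))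
    (hD : 0 < (D : ℝ)) :
    0 ≤ ∑' m : ℕ, ‖divisorSumChar χ (m + D ^ 4)‖ ^ 2 *
        Real.exp (-((m + D ^ 4 : ℕ) / (D : ℝ) ^ 6)) / (m + D ^ 4 : ℕ) ∧
    ∑' m : ℕ, ‖divisorSumChar χ (m + D ^ 4)‖ ^ 2 *
        Real.exp (-((m + D ^ 4 : ℕ) / (D : ℝ) ^ 6)) / (m + D ^ 4 : ℕ) ≤
      ∑ n ∈ Finset.Ico (D ^ 4) (D ^ 8 + 1), ‖divisorSumChar χ n‖ ^ 2 / n +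
        384 / (D : ℝ) ^ 8 * (Cd ^ 2 * (2 * (D : ℝ) ^ 6 + 1)) := by
  have hY : 0 < (D : ℝ) ^ 6 := by positivity
  have hY2 : 0 < 2 * (D : ℝ) ^ 6 := by positivity
  set a : ℕ → ℝ := fun n => ‖divisorSumChar χ n‖ ^ 2 * Real.exp (-(n / (D : ℝ) ^ 6)) / n with ha
  set a' : ℕ → ℝ := fun n => ‖divisorSumChar χ n‖ ^ 2 * Real.exp (-(n / (2 * (D : ℝ) ^ 6))) / n
    with ha'
  have hsa : Summable a := summable_nuSq χ hY
  have hsa' : Summable a' := summable_nuSq χ hY2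
  have ha0 : ∀ n, 0 ≤ a n := fun n => by simp only [ha]; positivity
  have ha'0 : ∀ n, 0 ≤ a' n := fun n => by simp only [ha']; positivity
  have hsaT : Summable fun m : ℕ => a (m + D ^ 4) := (summable_nat_add_iff (D ^ 4)).2 hsa
  show 0 ≤ ∑' m : ℕ, a (m + D ^ 4) ∧ ∑' m : ℕ, a (m + D ^ 4) ≤ _
  refine ⟨tsum_nonneg fun m => ha0 _, ?_⟩
  -- split the tail at `n = D⁸ + 1`
  set K : ℕ := D ^ 8 + 1 - D ^ 4 with hK
  have hK4 : D ^ 4 ≤ D ^ 8 + 1 := by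
    have : D ^ 4 ≤ D ^ 8 := by
      rcases Nat.eq_zero_or_pos D with h | h
      · subst h; simp
      · exact Nat.pow_le_pow_right h (by norm_num)
    omega
  have hKD : K + D ^ 4 = D ^ 8 + 1 := by rw [hK]; omega
  have hsplit := (Summable.sum_add_tsum_nat_add K hsaT).symm
  rw [hsplit]
  -- the middle block `D⁴ ≤ n ≤ D⁸`
  have hmid : ∑ i ∈ Finset.range K, a (i + D ^ 4) ≤
      ∑ n ∈ Finset.Ico (D ^ 4) (D ^ 8 + 1), ‖divisorSumChar χ n‖ ^ 2 / n := by
    have e : ∑ n ∈ Finset.Ico (D ^ 4) (D ^ 8 + 1), ‖divisorSumChar χ n‖ ^ 2 / n =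
        ∑ i ∈ Finset.range K, ‖divisorSumChar χ (i + D ^ 4)‖ ^ 2 / (i + D ^ 4 : ℕ) := by
      rw [Finset.sum_Ico_eq_sum_range]
      refine Finset.sum_congr rfl fun i _ => ?_
      rw [add_comm]
    rw [e]
    refine Finset.sum_le_sum fun i _ => ?_
    simp only [ha]
    have h1 : Real.exp (-((i + D ^ 4 : ℕ) / (D : ℝ) ^ 6)) ≤ 1 := by
      rw [Real.exp_le_one_iff]
      have : (0 : ℝ) ≤ (i + D ^ 4 : ℕ) / (D : ℝ) ^ 6 := by positivity
      linarith
    have h0 : 0 ≤ ‖divisorSumChar χ (i + D ^ 4)‖ ^ 2 := sq_nonneg _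
    refine div_le_div_of_nonneg_right ?_ (Nat.cast_nonneg _)
    calc ‖divisorSumChar χ (i + D ^ 4)‖ ^ 2 * Real.exp (-((i + D ^ 4 : ℕ) / (D : ℝ) ^ 6))
        ≤ ‖divisorSumChar χ (i + D ^ 4)‖ ^ 2 * 1 := by gcongr
      _ = _ := by ring
  -- the far block `n ≥ D⁸ + 1`
  have hfar : ∑' i : ℕ, a (i + K + D ^ 4) ≤ 384 / (D : ℝ) ^ 8 * (Cd ^ 2 * (2 * (D : ℝ) ^ 6 + 1)) := by
    have hsf : Summable fun i : ℕ => a' (i + (D ^ 8 + 1)) := (summable_nat_add_iff (D ^ 8 + 1)).2 hsa'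
    have hterm : ∀ i : ℕ, a (i + K + D ^ 4) ≤ 384 / (D : ℝ) ^ 8 * a' (i + (D ^ 8 + 1)) := by
      intro i
      have e : i + K + D ^ 4 = i + (D ^ 8 + 1) := by rw [add_assoc, hKD]
      rw [e]
      exact far_term_le χ hD (by omega)
    have hs1 : Summable fun i : ℕ => a (i + K + D ^ 4) := by
      have : (fun i : ℕ => a (i + K + D ^ 4)) = fun i : ℕ => a (i + (K + D ^ 4)) := by
        funext i; rw [add_assoc]
      rw [this]; exact (summable_nat_add_iff (K + D ^ 4)).2 hsa
    have htail' : ∑' i : ℕ, a' (i + (D ^ 8 + 1)) ≤ ∑' n : ℕ, a' n := by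
      rw [← Summable.sum_add_tsum_nat_add (D ^ 8 + 1) hsa']
      have : 0 ≤ ∑ i ∈ Finset.range (D ^ 8 + 1), a' i := Finset.sum_nonneg fun i _ => ha'0 i
      linarith
    have hfull := tsum_nuSq_le χ hCd hY2
    have h384 : 0 ≤ 384 / (D : ℝ) ^ 8 := by positivity
    calc ∑' i : ℕ, a (i + K + D ^ 4) ≤ ∑' i : ℕ, 384 / (D : ℝ) ^ 8 * a' (i + (D ^ 8 + 1)) :=
          Summable.tsum_le_tsum hterm hs1 (hsf.mul_left _)
      _ = 384 / (D : ℝ) ^ 8 * ∑' i : ℕ, a' (i + (D ^ 8 + 1)) := tsum_mul_left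
      _ ≤ 384 / (D : ℝ) ^ 8 * ∑' n : ℕ, a' n := mul_le_mul_of_nonneg_left htail' h384
      _ ≤ 384 / (D : ℝ) ^ 8 * (Cd ^ 2 * (2 * (D : ℝ) ^ 6 + 1)) :=
          mul_le_mul_of_nonneg_left hfull h384
  exact add_le_add hmid hfar

/-- `∑_{D⁴ ≤ n ≤ D⁸} = ` the term `n = D⁴` ` + ∑_{D⁴ < n ≤ D⁸}`, with
`|ν(D⁴)|²/D⁴ ≤ C_d²/D³`. [folklore] -/
theorem sum_Ico_le {Cd : ℝ} (hCd : ∀ n : ℕ, (n.divisors.card : ℝ) ≤ Cd * (n : ℝ) ^ (1 / 8 : ℝ))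
    (hD : 0 < (D : ℝ)) :
    ∑ n ∈ Finset.Ico (D ^ 4) (D ^ 8 + 1), ‖divisorSumChar χ n‖ ^ 2 / n ≤
      Cd ^ 2 / (D : ℝ) ^ 3 + ∑ n ∈ Finset.Ioc (D ^ 4) (D ^ 8), ‖divisorSumChar χ n‖ ^ 2 / n := by
  have hlt : D ^ 4 < D ^ 8 + 1 := by
    have : D ^ 4 ≤ D ^ 8 := by
      rcases Nat.eq_zero_or_pos D with h | h
      · subst h; simp
      · exact Nat.pow_le_pow_right h (by norm_num)
    omega
  have hIoc : Finset.Ico (D ^ 4 + 1) (D ^ 8 + 1) = Finset.Ioc (D ^ 4) (D ^ 8) := by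
    ext n; simp only [Finset.mem_Ico, Finset.mem_Ioc]; omega
  rw [Finset.sum_eq_sum_Ico_succ_bot hlt, hIoc]
  gcongr ?_ + _
  have hν := norm_nu_sq_le χ hCd (D ^ 4)
  have e : ((D ^ 4 : ℕ) : ℝ) ^ (1 / 4 : ℝ) = D := by
    push_cast
    rw [← Real.rpow_natCast, ← Real.rpow_mul hD.le]; norm_num
  rw [e] at hν
  have hD4 : (0 : ℝ) < ((D ^ 4 : ℕ) : ℝ) := by push_cast; exact pow_pos hD 4
  rw [div_le_iff₀ hD4]
  calc ‖divisorSumChar χ (D ^ 4)‖ ^ 2 ≤ Cd ^ 2 * D := hν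
    _ = Cd ^ 2 / (D : ℝ) ^ 3 * ((D ^ 4 : ℕ) : ℝ) := by push_cast; field_simp

/-- **The smoothing step of Lemma 17.1** (the source inserts the weight "by Lemma 3.1"): for `χ`
quadratic mod `D ≥ 1`, with `C_d` the divisor-bound constant at exponent `1/8`,
`|∑_{n<D⁴} |ν(n)|²/n − W_{ν²}(D⁶)| ≤ ∑_{D⁴<n≤D⁸} |ν(n)|²/n + 1154 C_d²/D`
(`W_{ν²}(X) = ∑ ν(n)² e^{-n/X}/n`). [cite: Zhang2022LandauSiegel, App. B, proof of Lemma 17.1] -/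
theorem abs_sum_sub_W_re_le (hχ : χ ^ 2 = 1) {Cd : ℝ}
    (hCd : ∀ n : ℕ, (n.divisors.card : ℝ) ≤ Cd * (n : ℝ) ^ (1 / 8 : ℝ)) (hD1 : 1 ≤ (D : ℝ)) :
    |∑ n ∈ Finset.range (D ^ 4), ‖divisorSumChar χ n‖ ^ 2 / n -
        (W (fun n => divisorSumChar χ n ^ 2) ((D : ℝ) ^ 6)).re| ≤
      ∑ n ∈ Finset.Ioc (D ^ 4) (D ^ 8), ‖divisorSumChar χ n‖ ^ 2 / n + 1154 * Cd ^ 2 / D := by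
  have hD : 0 < (D : ℝ) := by linarith
  have hY : 0 < (D : ℝ) ^ 6 := by positivity
  set a : ℕ → ℝ := fun n => ‖divisorSumChar χ n‖ ^ 2 * Real.exp (-(n / (D : ℝ) ^ 6)) / n with ha
  have hsa : Summable a := summable_nuSq χ hY
  have hre : (W (fun n => divisorSumChar χ n ^ 2) ((D : ℝ) ^ 6)).re = ∑' n, a n := by
    rw [W_nuSq_eq χ hχ, ofReal_re]
  rw [hre, ← Summable.sum_add_tsum_nat_add (D ^ 4) hsa]
  obtain ⟨hh0, hh⟩ := head_sub_le χ hCd hY (D := D)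
  obtain ⟨ht0, ht⟩ := tail_le χ hCd hD
  have hI := sum_Ico_le χ hCd hD
  set S : ℝ := ∑ n ∈ Finset.range (D ^ 4), ‖divisorSumChar χ n‖ ^ 2 / n
  set H : ℝ := ∑ n ∈ Finset.range (D ^ 4), a n
  set T : ℝ := ∑' m : ℕ, a (m + D ^ 4)
  set M : ℝ := ∑ n ∈ Finset.Ioc (D ^ 4) (D ^ 8), ‖divisorSumChar χ n‖ ^ 2 / n
  have hM0 : 0 ≤ M := Finset.sum_nonneg fun n _ => by positivity
  have hCd0 : 0 ≤ Cd ^ 2 := sq_nonneg _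
  -- sizes of the elementary error terms, all `≤ const · C_d²/D`
  have e1 : Cd ^ 2 * (D : ℝ) ^ 5 / (D : ℝ) ^ 6 = Cd ^ 2 / D := by
    field_simp
  have b2 : Cd ^ 2 / (D : ℝ) ^ 3 ≤ Cd ^ 2 / D := by
    apply div_le_div_of_nonneg_left hCd0 hD
    calc (D : ℝ) = D ^ 1 := (pow_one _).symm
      _ ≤ D ^ 3 := pow_le_pow_right₀ hD1 (by norm_num)
  have b3 : 384 / (D : ℝ) ^ 8 * (Cd ^ 2 * (2 * (D : ℝ) ^ 6 + 1)) ≤ 1152 * Cd ^ 2 / D := by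
    have h1 : 2 * (D : ℝ) ^ 6 + 1 ≤ 3 * (D : ℝ) ^ 7 := by
      have h6 : (1 : ℝ) ≤ (D : ℝ) ^ 6 := one_le_pow₀ hD1
      have h67 : (D : ℝ) ^ 6 ≤ (D : ℝ) ^ 7 := pow_le_pow_right₀ hD1 (by norm_num)
      linarith
    calc 384 / (D : ℝ) ^ 8 * (Cd ^ 2 * (2 * (D : ℝ) ^ 6 + 1))
        ≤ 384 / (D : ℝ) ^ 8 * (Cd ^ 2 * (3 * (D : ℝ) ^ 7)) := by gcongr
      _ = 1152 * Cd ^ 2 / D := by field_simp; ring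
  rw [e1] at hh
  have hq : 0 ≤ Cd ^ 2 / D := by positivity
  have e3 : (1152 : ℝ) * Cd ^ 2 / D = 1152 * (Cd ^ 2 / D) := by ring
  have e4 : (1154 : ℝ) * Cd ^ 2 / D = 1154 * (Cd ^ 2 / D) := by ring
  rw [e3] at b3
  rw [e4]
  have hT : T ≤ Cd ^ 2 / D + M + 1152 * (Cd ^ 2 / D) := by linarith
  rw [abs_le]
  constructor <;> linarith

end Smoothing2

/-! ### §4. Bounds in the strip `−1/4 ≤ re z ≤ 2`; the lines and the horizontal decay -/

section Strip

variable (X) in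
/-- The constant of the strip bound for `F`. [folklore] -/
def KF (D : ℕ) : ℝ :=
  16 * 5 ^ 8 * (4 * CΓ) * (X ^ (-(1 / 4) : ℝ) + X ^ (2 : ℝ)) *
    (9 * ((D : ℝ) * Zconst) ^ 2 * phiBound D)

omit [NeZero D] in
/-- `K_F ≥ 0`. [folklore] -/
theorem KF_nonneg (hX : 0 < X) (D : ℕ) : 0 ≤ KF X D := by
  unfold KF
  have := CΓ_pos
  have := Zconst_nonneg
  have := phiBound_pos D
  positivity

/-- **`F` in the strip**: for `χ ≠ 1`, `−1/4 ≤ re z ≤ 2`, `‖z‖ ≥ 1/4`,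
`‖F(z)‖ ≤ K_F (1+|im z|)¹³ e^{-π|im z|/2}`. [folklore] -/
theorem norm_Fint_le (hχ1 : χ ≠ 1) (hX : 0 < X) {z : ℂ}
    (h1 : -(1 / 4) ≤ z.re) (h2 : z.re ≤ 2) (hz : 1 / 4 ≤ ‖z‖) :
    ‖Fint χ X z‖ ≤ KF X D * ((1 + |z.im|) ^ 13 * Real.exp (-(π * |z.im| / 2))) := by
  have hy0 := abs_nonneg z.im
  have hz0 : z ≠ 0 := by
    intro h; rw [h, norm_zero] at hz; norm_num at hz
  have hzpos : 0 < ‖z‖ := by linarith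
  have hzn : ‖z‖ ≤ 2 + |z.im| := by
    have := Complex.norm_le_abs_re_add_abs_im z
    have : |z.re| ≤ 2 := abs_le.2 ⟨by linarith, h2⟩
    linarith
  have h1z : ‖(1 : ℂ) + z‖ ≤ 3 * (1 + |z.im|) := by
    have := norm_add_le (1 : ℂ) z
    rw [norm_one] at this
    linarith
  have hz1 : (1 : ℂ) + z ≠ 1 := by intro h; exact hz0 (by linear_combination h)
  -- ζ(1+z) = ζ₁(1+z)/z
  have hζ₁ : ‖riemannZeta₁ (1 + z)‖ ≤ 5 ^ 4 * (1 + |z.im|) ^ 4 := by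
    have h := BurnolVectors.norm_riemannZeta₁_le (s := 1 + z) (by simp; linarith)
    refine h.trans ?_
    have : ‖(1 : ℂ) + z‖ + 2 ≤ 5 * (1 + |z.im|) := by linarith
    calc (‖(1 : ℂ) + z‖ + 2) ^ 4 ≤ (5 * (1 + |z.im|)) ^ 4 := by gcongr
      _ = 5 ^ 4 * (1 + |z.im|) ^ 4 := by ring
  have hζ : ‖riemannZeta (1 + z)‖ ≤ 4 * (5 ^ 4 * (1 + |z.im|) ^ 4) := by
    have e : riemannZeta (1 + z) = riemannZeta₁ (1 + z) / z := by
      rw [LFunctions.riemannZeta₁_eq_mul hz1, add_sub_cancel_left]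
      field_simp
    rw [e, norm_div, div_le_iff₀ hzpos]
    calc ‖riemannZeta₁ (1 + z)‖ ≤ 5 ^ 4 * (1 + |z.im|) ^ 4 := hζ₁
      _ = 4 * (5 ^ 4 * (1 + |z.im|) ^ 4) * (1 / 4) := by ring
      _ ≤ 4 * (5 ^ 4 * (1 + |z.im|) ^ 4) * ‖z‖ := by gcongr
  have hζ2 : ‖riemannZeta (1 + z)‖ ^ 2 ≤ 16 * 5 ^ 8 * (1 + |z.im|) ^ 8 := by
    calc ‖riemannZeta (1 + z)‖ ^ 2 ≤ (4 * (5 ^ 4 * (1 + |z.im|) ^ 4)) ^ 2 :=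
          pow_le_pow_left₀ (norm_nonneg _) hζ 2
      _ = 16 * 5 ^ 8 * (1 + |z.im|) ^ 8 := by ring
  -- Γ(z) = Γ(z+1)/z
  have hΓ1 : ‖Complex.Gamma (z + 1)‖ ≤ CΓ * (1 + |z.im|) ^ 3 * Real.exp (-(π * |z.im| / 2)) := by
    have := norm_Gamma_strip_le (x := z.re + 1) (by linarith) (by linarith) z.im
    have e : ((z.re + 1 : ℝ) : ℂ) + z.im * I = z + 1 := by
      rw [show ((z.re + 1 : ℝ) : ℂ) = (z.re : ℂ) + 1 by push_cast; ring]
      conv_rhs => rw [← Complex.re_add_im z]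
      ring
    rwa [e] at this
  have hC := CΓ_pos
  have hE := Real.exp_pos (-(π * |z.im| / 2))
  have hΓ : ‖Complex.Gamma z‖ ≤ 4 * CΓ * (1 + |z.im|) ^ 3 * Real.exp (-(π * |z.im| / 2)) := by
    have e : Complex.Gamma z = Complex.Gamma (z + 1) / z := by
      rw [Complex.Gamma_add_one _ hz0]; field_simp
    rw [e, norm_div, div_le_iff₀ hzpos]
    calc ‖Complex.Gamma (z + 1)‖ ≤ CΓ * (1 + |z.im|) ^ 3 * Real.exp (-(π * |z.im| / 2)) := hΓ1
      _ = 4 * CΓ * (1 + |z.im|) ^ 3 * Real.exp (-(π * |z.im| / 2)) * (1 / 4) := by ring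
      _ ≤ 4 * CΓ * (1 + |z.im|) ^ 3 * Real.exp (-(π * |z.im| / 2)) * ‖z‖ := by gcongr
  -- X^z
  have hXz : ‖(X : ℂ) ^ z‖ ≤ X ^ (-(1 / 4) : ℝ) + X ^ (2 : ℝ) := by
    rw [Complex.norm_cpow_eq_rpow_re_of_pos hX]
    exact rpow_le_rpow_add hX h1 h2
  -- g
  have hZ0 := Zconst_nonneg
  have hφ0 := phiBound_pos D
  have hg : ‖gFun χ z‖ ≤ 9 * ((D : ℝ) * Zconst) ^ 2 * phiBound D * (1 + |z.im|) ^ 2 := by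
    refine (norm_gFun_le χ hχ1 h1).trans ?_
    calc ((D : ℝ) * ‖(1 : ℂ) + z‖ * Zconst) ^ 2 * phiBound D
        ≤ ((D : ℝ) * (3 * (1 + |z.im|)) * Zconst) ^ 2 * phiBound D := by gcongr
      _ = _ := by ring
  -- combine
  have hXs : 0 ≤ X ^ (-(1 / 4) : ℝ) + X ^ (2 : ℝ) := by positivity
  have s1 : ‖riemannZeta (1 + z)‖ ^ 2 * ‖Complex.Gamma z‖ ≤
      (16 * 5 ^ 8 * (1 + |z.im|) ^ 8) * (4 * CΓ * (1 + |z.im|) ^ 3 * Real.exp (-(π * |z.im| / 2))) :=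
    mul_le_mul hζ2 hΓ (norm_nonneg _) (by positivity)
  have s2 : ‖riemannZeta (1 + z)‖ ^ 2 * ‖Complex.Gamma z‖ * ‖(X : ℂ) ^ z‖ ≤
      (16 * 5 ^ 8 * (1 + |z.im|) ^ 8) * (4 * CΓ * (1 + |z.im|) ^ 3 * Real.exp (-(π * |z.im| / 2))) *
        (X ^ (-(1 / 4) : ℝ) + X ^ (2 : ℝ)) :=
    mul_le_mul s1 hXz (norm_nonneg _) (by positivity)
  have s3 : ‖riemannZeta (1 + z)‖ ^ 2 * ‖Complex.Gamma z‖ * ‖(X : ℂ) ^ z‖ * ‖gFun χ z‖ ≤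
      (16 * 5 ^ 8 * (1 + |z.im|) ^ 8) * (4 * CΓ * (1 + |z.im|) ^ 3 * Real.exp (-(π * |z.im| / 2))) *
        (X ^ (-(1 / 4) : ℝ) + X ^ (2 : ℝ)) *
        (9 * ((D : ℝ) * Zconst) ^ 2 * phiBound D * (1 + |z.im|) ^ 2) :=
    mul_le_mul s2 hg (norm_nonneg _) (by positivity)
  rw [Fint, norm_mul, norm_mul, norm_mul, norm_pow]
  refine s3.trans (le_of_eq ?_)
  rw [KF]; ring

/-- `y ↦ F(c+iy)` is continuous for `c > −1/2`, `c ≠ 0`. [folklore] -/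
theorem continuous_Fint_line (hχ1 : χ ≠ 1) (hX : 0 < X) {c : ℝ}
    (hc : -(1 / 2) < c) (hc0 : c ≠ 0) :
    Continuous fun y : ℝ => Fint χ X (c + y * I) := by
  have hd := differentiableOn_Fint χ hχ1 hX
  have hline : Continuous fun y : ℝ => (c : ℂ) + y * I := by fun_prop
  refine hd.continuousOn.comp_continuous hline fun y => ⟨?_, ?_⟩
  · simp only [mem_setOf_eq, add_re, ofReal_re, mul_re, I_re, mul_zero, ofReal_im, I_im, mul_one,
      sub_self, add_zero]; exact hc
  · intro h
    have := congrArg Complex.re h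
    simp at this
    exact hc0 this

/-- Integrability of `F` on the lines `re z = −1/4` and `re z = 2`. [folklore] -/
theorem integrable_Fint_line (hχ1 : χ ≠ 1) (hX : 0 < X) {c : ℝ}
    (hc : c = -(1 / 4) ∨ c = 2) :
    Integrable fun y : ℝ => Fint χ X (c + y * I) := by
  have hc1 : -(1 / 4) ≤ c := by rcases hc with h | h <;> norm_num [h]
  have hc2 : c ≤ 2 := by rcases hc with h | h <;> norm_num [h]
  have hca : 1 / 4 ≤ |c| := by
    rcases hc with h | h <;> (rw [h]; norm_num [abs_of_neg, abs_of_pos])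
  have hc0 : c ≠ 0 := by intro h; rw [h] at hca; norm_num at hca
  have hcont := continuous_Fint_line χ hχ1 hX (c := c) (by linarith) hc0
  refine (((integrable_pow_mul_exp 13).const_mul (KF X D)).mono' hcont.aestronglyMeasurable
    (Eventually.of_forall fun y => ?_))
  have hw : 1 / 4 ≤ ‖((c : ℂ) + y * I)‖ := by
    have hre : (((c : ℂ) + y * I)).re = c := by simp
    have := abs_re_le_norm (((c : ℂ) + y * I))
    rw [hre] at this
    exact hca.trans this
  have him : (((c : ℂ) + y * I)).im = y := by simp
  have hb := norm_Fint_le χ hχ1 hX (z := ((c : ℂ) + y * I)) (by simpa using hc1)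
    (by simpa using hc2) hw
  rw [him] at hb
  exact hb

/-- Horizontal decay of `F` in the strip. [folklore] -/
theorem Fint_horizontal_decay (hχ1 : χ ≠ 1) (hX : 0 < X) (ε : ℝ) (hε : 0 < ε) :
    ∃ T₀ : ℝ, ∀ T : ℝ, T₀ ≤ |T| → ∀ u ∈ Icc (-(1 / 4) : ℝ) 2, ‖Fint χ X (u + T * I)‖ ≤ ε := by
  have hK0 := KF_nonneg (X := X) hX D
  obtain ⟨T₁, hT₁⟩ := exists_pow_mul_exp_le 13 hK0 hε
  refine ⟨max T₁ 1, fun T hT u hu => ?_⟩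
  have hTT : T₁ ≤ |T| := le_trans (le_max_left _ _) hT
  have hT1 : 1 ≤ |T| := le_trans (le_max_right _ _) hT
  set w : ℂ := (u : ℂ) + T * I with hw
  have hwim : w.im = T := by simp [hw]
  have hwre : w.re = u := by simp [hw]
  have hwn : 1 / 4 ≤ ‖w‖ := by
    have := abs_im_le_norm w; rw [hwim] at this; linarith
  have hb := norm_Fint_le χ hχ1 hX (z := w) (by rw [hwre]; exact hu.1) (by rw [hwre]; exact hu.2) hwn
  rw [hwim] at hb
  exact hb.trans (hT₁ T hTT)

end Strip

/-! ### §5. The line `re z = −1/4` with the `D`-dependence explicit -/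

section LineBound

/-- The absolute constant of the line bound. [folklore] -/
def Kline17 : ℝ := 16 * 5 ^ 8 * (4 * CΓ) * (27 * Real.exp 3)

omit [NeZero D] in
/-- `Kline17 > 0`. [folklore] -/
theorem Kline17_pos : 0 < Kline17 := by unfold Kline17; have := CΓ_pos; positivity

/-- **`F` on the line `re z = −1/4`** (`χ` primitive mod `D ≥ 8`):
`‖F(−1/4+iy)‖ ≤ K d(D)² D^{1/4} (1+𝓛)³ X^{-1/4} (1+|y|)¹³ e^{-π|y|/2}` (`L(3/4+it,χ)` by the tree's
Pólya–Vinogradov-strength bound, through `Lemma31.norm_gFun_line_le`).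
[cite: Zhang2022LandauSiegel, App. B, proof of Lemma 17.1 ("plus an acceptable error")] -/
theorem norm_Fint_line_le (hprim : χ.IsPrimitive) (hD8 : 8 ≤ D) (hX : 0 < X) (y : ℝ) :
    ‖Fint χ X (((-(1 / 4) : ℝ) : ℂ) + y * I)‖ ≤
      Kline17 * (D.divisors.card : ℝ) ^ 2 * (D : ℝ) ^ (1 / 4 : ℝ) * (1 + Real.log D) ^ 3 *
        X ^ (-(1 / 4) : ℝ) * ((1 + |y|) ^ 13 * Real.exp (-(π * |y| / 2))) := by
  have hD0 : D ≠ 0 := by omega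
  generalize hzdef : (((-(1 / 4) : ℝ) : ℂ) + y * I) = z
  have hzre : z.re = -(1 / 4) := by rw [← hzdef]; simp
  have hzim : z.im = y := by rw [← hzdef]; simp
  have hy0 := abs_nonneg y
  have hz : 1 / 4 ≤ ‖z‖ := by
    have := Complex.abs_re_le_norm z
    rw [hzre, abs_neg, abs_of_pos (by norm_num : (0:ℝ) < 1 / 4)] at this
    exact this
  have hzpos : 0 < ‖z‖ := by linarith
  have hz0 : z ≠ 0 := by
    intro h; rw [h, norm_zero] at hz; norm_num at hz
  have hzn : ‖z‖ ≤ 1 / 4 + |y| := by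
    have := Complex.norm_le_abs_re_add_abs_im z
    rw [hzre, hzim, abs_neg, abs_of_pos (by norm_num : (0:ℝ) < 1 / 4)] at this
    exact this
  have h1z : ‖(1 : ℂ) + z‖ ≤ 3 * (1 + |y|) := by
    have := norm_add_le (1 : ℂ) z
    rw [norm_one] at this
    linarith
  have hz1 : (1 : ℂ) + z ≠ 1 := by intro h; exact hz0 (by linear_combination h)
  have hζ₁ : ‖riemannZeta₁ (1 + z)‖ ≤ 5 ^ 4 * (1 + |y|) ^ 4 := by
    have h := BurnolVectors.norm_riemannZeta₁_le (s := 1 + z) (by rw [add_re, one_re, hzre]; norm_num)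
    refine h.trans ?_
    have : ‖(1 : ℂ) + z‖ + 2 ≤ 5 * (1 + |y|) := by linarith
    calc (‖(1 : ℂ) + z‖ + 2) ^ 4 ≤ (5 * (1 + |y|)) ^ 4 := by gcongr
      _ = 5 ^ 4 * (1 + |y|) ^ 4 := by ring
  have hζ : ‖riemannZeta (1 + z)‖ ≤ 4 * (5 ^ 4 * (1 + |y|) ^ 4) := by
    have e : riemannZeta (1 + z) = riemannZeta₁ (1 + z) / z := by
      rw [LFunctions.riemannZeta₁_eq_mul hz1, add_sub_cancel_left]
      field_simp
    rw [e, norm_div, div_le_iff₀ hzpos]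
    calc ‖riemannZeta₁ (1 + z)‖ ≤ 5 ^ 4 * (1 + |y|) ^ 4 := hζ₁
      _ = 4 * (5 ^ 4 * (1 + |y|) ^ 4) * (1 / 4) := by ring
      _ ≤ 4 * (5 ^ 4 * (1 + |y|) ^ 4) * ‖z‖ := by gcongr
  have hζ2 : ‖riemannZeta (1 + z)‖ ^ 2 ≤ 16 * 5 ^ 8 * (1 + |y|) ^ 8 := by
    calc ‖riemannZeta (1 + z)‖ ^ 2 ≤ (4 * (5 ^ 4 * (1 + |y|) ^ 4)) ^ 2 :=
          pow_le_pow_left₀ (norm_nonneg _) hζ 2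
      _ = 16 * 5 ^ 8 * (1 + |y|) ^ 8 := by ring
  have hΓ1 : ‖Complex.Gamma (z + 1)‖ ≤ CΓ * (1 + |y|) ^ 3 * Real.exp (-(π * |y| / 2)) := by
    have := norm_Gamma_strip_le (x := z.re + 1) (by rw [hzre]; norm_num) (by rw [hzre]; norm_num) z.im
    have e : ((z.re + 1 : ℝ) : ℂ) + z.im * I = z + 1 := by
      rw [show ((z.re + 1 : ℝ) : ℂ) = (z.re : ℂ) + 1 by push_cast; ring]
      conv_rhs => rw [← Complex.re_add_im z]
      ring
    rwa [e, hzim] at this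
  have hC := CΓ_pos
  have hE := Real.exp_pos (-(π * |y| / 2))
  have hΓ : ‖Complex.Gamma z‖ ≤ 4 * CΓ * (1 + |y|) ^ 3 * Real.exp (-(π * |y| / 2)) := by
    have e : Complex.Gamma z = Complex.Gamma (z + 1) / z := by
      rw [Complex.Gamma_add_one _ hz0]; field_simp
    rw [e, norm_div, div_le_iff₀ hzpos]
    calc ‖Complex.Gamma (z + 1)‖ ≤ CΓ * (1 + |y|) ^ 3 * Real.exp (-(π * |y| / 2)) := hΓ1
      _ = 4 * CΓ * (1 + |y|) ^ 3 * Real.exp (-(π * |y| / 2)) * (1 / 4) := by ring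
      _ ≤ 4 * CΓ * (1 + |y|) ^ 3 * Real.exp (-(π * |y| / 2)) * ‖z‖ := by gcongr
  -- X^z on the line
  have hXz : ‖(X : ℂ) ^ z‖ = X ^ (-(1 / 4) : ℝ) := by
    rw [Complex.norm_cpow_eq_rpow_re_of_pos hX, hzre]
  -- g by `Lemma31.norm_gFun_line_le`
  have hg := norm_gFun_line_le χ hprim hD8 hzre
  rw [hzim] at hg
  set T : ℝ := (D.divisors.card : ℝ) ^ 2 * (D : ℝ) ^ (1 / 4 : ℝ) * (1 + Real.log D) ^ 3 with hT
  have hlog0 : 0 ≤ Real.log D := Real.log_nonneg (by exact_mod_cast Nat.one_le_iff_ne_zero.2 hD0)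
  have hT0 : 0 ≤ T := by positivity
  have hg' : ‖gFun χ z‖ ≤ 27 * Real.exp 3 * T * (1 + |y|) ^ 2 := by
    refine hg.trans (le_of_eq ?_); rw [hT]; ring
  have hX4 : 0 ≤ X ^ (-(1 / 4) : ℝ) := by positivity
  have s1 : ‖riemannZeta (1 + z)‖ ^ 2 * ‖Complex.Gamma z‖ ≤
      (16 * 5 ^ 8 * (1 + |y|) ^ 8) * (4 * CΓ * (1 + |y|) ^ 3 * Real.exp (-(π * |y| / 2))) :=
    mul_le_mul hζ2 hΓ (norm_nonneg _) (by positivity)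
  have s2 : ‖riemannZeta (1 + z)‖ ^ 2 * ‖Complex.Gamma z‖ * ‖(X : ℂ) ^ z‖ ≤
      (16 * 5 ^ 8 * (1 + |y|) ^ 8) * (4 * CΓ * (1 + |y|) ^ 3 * Real.exp (-(π * |y| / 2))) *
        X ^ (-(1 / 4) : ℝ) := by
    rw [hXz]; exact mul_le_mul_of_nonneg_right s1 hX4
  have s3 : ‖riemannZeta (1 + z)‖ ^ 2 * ‖Complex.Gamma z‖ * ‖(X : ℂ) ^ z‖ * ‖gFun χ z‖ ≤
      (16 * 5 ^ 8 * (1 + |y|) ^ 8) * (4 * CΓ * (1 + |y|) ^ 3 * Real.exp (-(π * |y| / 2))) *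
        X ^ (-(1 / 4) : ℝ) * (27 * Real.exp 3 * T * (1 + |y|) ^ 2) :=
    mul_le_mul s2 hg' (norm_nonneg _) (by positivity)
  rw [Fint, norm_mul, norm_mul, norm_mul, norm_pow]
  refine s3.trans (le_of_eq ?_)
  rw [Kline17, hT]; ring

/-- **The shifted integral** (`χ` primitive mod `D ≥ 8`):
`‖∫ F(−1/4+iy) dy‖ ≤ 2·28¹³ · K d(D)² D^{1/4} (1+𝓛)³ X^{-1/4}`. [folklore] -/
theorem norm_integral_Fint_line_le (hprim : χ.IsPrimitive) (hD8 : 8 ≤ D) (hX : 0 < X) :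
    ‖∫ y : ℝ, Fint χ X (((-(1 / 4) : ℝ) : ℂ) + y * I)‖ ≤
      2 * 28 ^ 13 * (Kline17 * (D.divisors.card : ℝ) ^ 2 * (D : ℝ) ^ (1 / 4 : ℝ) *
        (1 + Real.log D) ^ 3 * X ^ (-(1 / 4) : ℝ)) := by
  set K : ℝ := Kline17 * (D.divisors.card : ℝ) ^ 2 * (D : ℝ) ^ (1 / 4 : ℝ) *
    (1 + Real.log D) ^ 3 * X ^ (-(1 / 4) : ℝ) with hK
  have hD0 : D ≠ 0 := by omega
  have hlog0 : 0 ≤ Real.log D := Real.log_nonneg (by exact_mod_cast Nat.one_le_iff_ne_zero.2 hD0)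
  have hK0 : 0 ≤ K := by rw [hK]; have := Kline17_pos; positivity
  have hbound : ∀ y : ℝ, ‖Fint χ X (((-(1 / 4) : ℝ) : ℂ) + y * I)‖ ≤
      K * ((1 + |y|) ^ 13 * Real.exp (-(π * |y| / 2))) := by
    intro y
    have hb := norm_Fint_line_le χ hprim hD8 hX y
    rw [← hK] at hb
    exact hb
  have hint := (integrable_pow_mul_exp 13).const_mul K
  calc ‖∫ y : ℝ, Fint χ X (((-(1 / 4) : ℝ) : ℂ) + y * I)‖
      ≤ ∫ y : ℝ, K * ((1 + |y|) ^ 13 * Real.exp (-(π * |y| / 2))) :=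
        norm_integral_le_of_norm_le hint (Eventually.of_forall hbound)
    _ = K * ∫ y : ℝ, (1 + |y|) ^ 13 * Real.exp (-(π * |y| / 2)) := integral_const_mul _ _
    _ ≤ K * (2 * (2 * (13 : ℕ) + 2) ^ 13) := by
        gcongr; exact integral_pow_mul_exp_le 13
    _ = 2 * 28 ^ 13 * K := by norm_num; ring

end LineBound

/-! ### §6. Near `z = 0`: the residue of the pole of order three -/

section Residue

/-! #### §6.1 Differentiability of the pieces -/

omit [NeZero D] in
/-- `dslope a 0` is differentiable on `re z > −1/2` (at `0` because `a` is analytic there).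
[folklore] -/
theorem differentiableOn_dslope_aF {N : ℕ} (hX : 0 < X) :
    DifferentiableOn ℂ (dslope (aF N X) 0) {z : ℂ | -(1 / 2) < z.re} := by
  intro z hz
  rcases eq_or_ne z 0 with rfl | hz0
  · have hU : {z : ℂ | -(1 / 2) < z.re} ∈ 𝓝 (0 : ℂ) := isOpen_U.mem_nhds (by simp)
    obtain ⟨p, hp⟩ := (differentiableOn_aF (N := N) hX).analyticAt hU
    exact (hp.has_fpower_series_dslope_fslope.analyticAt).differentiableAt.differentiableWithinAt
  · exact ((differentiableAt_dslope_of_ne hz0).2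
      ((differentiableOn_aF (N := N) hX).differentiableAt (isOpen_U.mem_nhds hz))).differentiableWithinAt

/-- `a k` is differentiable on `re z > −1/2` (`χ ≠ 1`). [folklore] -/
theorem differentiableOn_aF_mul_kF (hχ1 : χ ≠ 1) (hX : 0 < X) :
    DifferentiableOn ℂ (fun z => aF D X z * kF χ z) {z : ℂ | -(1 / 2) < z.re} := fun z hz =>
  (differentiableOn_aF (N := D) hX z hz).mul ((differentiable_kF χ hχ1) z).differentiableWithinAt

/-- `a k²` is differentiable on `re z > −1/2` (`χ ≠ 1`). [folklore] -/
theorem differentiableOn_aF_mul_kF_sq (hχ1 : χ ≠ 1) (hX : 0 < X) :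
    DifferentiableOn ℂ (fun z => aF D X z * kF χ z ^ 2) {z : ℂ | -(1 / 2) < z.re} := fun z hz =>
  (differentiableOn_aF (N := D) hX z hz).mul
    (((differentiable_kF χ hχ1) z).pow 2).differentiableWithinAt

/-! #### §6.2 The residue in closed form -/

/-- **`dslope h 0` in terms of the pieces**:
`dslope h 0 (z) = L(1,χ)² dslope a 0 (z) + 2L(1,χ) (a k)(z) + z (a k²)(z)`. [folklore] -/
theorem dslope_hnum_eq (hχ1 : χ ≠ 1) (hX : 0 < X) (z : ℂ) :
    dslope (hnum χ X) 0 z = χ.LFunction 1 ^ 2 * dslope (aF D X) 0 z +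
      2 * χ.LFunction 1 * (aF D X z * kF χ z) + z * (aF D X z * kF χ z ^ 2) := by
  rcases eq_or_ne z 0 with rfl | hz0
  · -- at `z = 0`: the derivative of `h = L₀² a + 2L₀ (z·ak) + z²·ak²`
    rw [dslope_same, dslope_same, zero_mul, add_zero]
    have hU : {z : ℂ | -(1 / 2) < z.re} ∈ 𝓝 (0 : ℂ) := isOpen_U.mem_nhds (by simp)
    have ha : HasDerivAt (aF D X) (deriv (aF D X) 0) 0 :=
      ((differentiableOn_aF (N := D) hX).differentiableAt hU).hasDerivAt
    have hb : HasDerivAt (fun z => aF D X z * kF χ z) (deriv (fun z => aF D X z * kF χ z) 0) 0 :=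
      ((differentiableOn_aF_mul_kF χ hχ1 hX).differentiableAt hU).hasDerivAt
    have hc : HasDerivAt (fun z => aF D X z * kF χ z ^ 2)
        (deriv (fun z => aF D X z * kF χ z ^ 2) 0) 0 :=
      ((differentiableOn_aF_mul_kF_sq χ hχ1 hX).differentiableAt hU).hasDerivAt
    have h1 := (hasDerivAt_id' (0 : ℂ)).fun_mul hb
    have h2 := (hasDerivAt_pow 2 (0 : ℂ)).fun_mul hc
    have hsum := ((ha.const_mul (χ.LFunction 1 ^ 2)).fun_add
      (h1.const_mul (2 * χ.LFunction 1))).fun_add h2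
    have hfun : hnum χ X = fun z => χ.LFunction 1 ^ 2 * aF D X z +
        2 * χ.LFunction 1 * (z * (aF D X z * kF χ z)) + z ^ 2 * (aF D X z * kF χ z ^ 2) :=
      funext (hnum_eq χ)
    rw [hfun]
    refine (hsum.congr_deriv ?_).deriv
    simp
  · rw [dslope_of_ne _ hz0, dslope_of_ne _ hz0, slope_def_field, slope_def_field, sub_zero,
      hnum_eq χ z, hnum_eq χ 0]
    field_simp
    ring

/-- **The residue** `((swap dslope 0)^[2] h)(0) = (dslope h 0)′(0)` in closed form:
`= L(1,χ)² (dslope a 0)′(0) + 2L(1,χ) (a k)′(0) + a(0) k(0)²`.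
[cite: Zhang2022LandauSiegel, App. B, proof of Lemma 17.1 ("the residue … at s = 0")] -/
theorem residue_eq (hχ1 : χ ≠ 1) (hX : 0 < X) :
    (Function.swap dslope (0 : ℂ))^[2] (hnum χ X) 0 =
      χ.LFunction 1 ^ 2 * deriv (dslope (aF D X) 0) 0 +
        2 * χ.LFunction 1 * deriv (fun z => aF D X z * kF χ z) 0 + aF D X 0 * kF χ 0 ^ 2 := by
  show dslope (dslope (hnum χ X) 0) 0 0 = _
  rw [dslope_same]
  have hU : {z : ℂ | -(1 / 2) < z.re} ∈ 𝓝 (0 : ℂ) := isOpen_U.mem_nhds (by simp)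
  have ha : HasDerivAt (dslope (aF D X) 0) (deriv (dslope (aF D X) 0) 0) 0 :=
    ((differentiableOn_dslope_aF (N := D) hX).differentiableAt hU).hasDerivAt
  have hb : HasDerivAt (fun z => aF D X z * kF χ z) (deriv (fun z => aF D X z * kF χ z) 0) 0 :=
    ((differentiableOn_aF_mul_kF χ hχ1 hX).differentiableAt hU).hasDerivAt
  have hc : HasDerivAt (fun z => aF D X z * kF χ z ^ 2)
      (deriv (fun z => aF D X z * kF χ z ^ 2) 0) 0 :=
    ((differentiableOn_aF_mul_kF_sq χ hχ1 hX).differentiableAt hU).hasDerivAt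
  have h2 := (hasDerivAt_id' (0 : ℂ)).fun_mul hc
  have hsum := ((ha.const_mul (χ.LFunction 1 ^ 2)).fun_add
    (hb.const_mul (2 * χ.LFunction 1))).fun_add h2
  have hfun : dslope (hnum χ X) 0 = fun z => χ.LFunction 1 ^ 2 * dslope (aF D X) 0 z +
      2 * χ.LFunction 1 * (aF D X z * kF χ z) + z * (aF D X z * kF χ z ^ 2) :=
    funext (dslope_hnum_eq χ hχ1 hX)
  rw [hfun]
  refine (hsum.congr_deriv ?_).deriv
  simp

/-- The main term: `a(0) k(0)² = φ(1) L′(1,χ)²`. [folklore] -/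
theorem aF_zero_mul_kF_zero_sq : aF D X 0 * kF χ 0 ^ 2 = phi D 1 * deriv χ.LFunction 1 ^ 2 := by
  rw [aF, uF_zero, kF_zero, one_mul, add_zero]

/-! #### §6.3 Sizes on the disc `|z| ≤ 1/(4𝓛)` -/

/-- The absolute constant bounding `a` near `0`. [folklore] -/
def Ma : ℝ := (13 / 4 : ℝ) ^ 8 * (2 * CΓ) * Real.exp (3 / 2) * 3

omit [NeZero D] in
/-- `Ma ≥ 0`. [folklore] -/
theorem Ma_nonneg : 0 ≤ Ma := by unfold Ma; have := CΓ_pos; positivity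

omit [NeZero D] in
/-- **`u` near `0`**: for `X ≥ 1` with `log X ≤ 6𝓛` (`𝓛 = log D ≥ 3`) and `‖z‖ ≤ 1/(4𝓛)`,
`‖u(z)‖ ≤ (13/4)⁸ · 2C_Γ · e^{3/2}`. [folklore] -/
theorem norm_uF_le (hL : 3 ≤ Real.log D) (hX1 : 1 ≤ X) (hXL : Real.log X ≤ 6 * Real.log D)
    {z : ℂ} (hz : ‖z‖ ≤ 1 / (4 * Real.log D)) :
    ‖uF X z‖ ≤ (13 / 4 : ℝ) ^ 8 * (2 * CΓ) * Real.exp (3 / 2) := by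
  set Lg : ℝ := Real.log D with hLdef
  have hL0 : 0 < Lg := by linarith
  have hX0 : 0 < X := by linarith
  have hr9 : ‖z‖ ≤ 1 / 9 := by
    refine hz.trans ?_
    rw [div_le_div_iff₀ (by positivity) (by norm_num)]; linarith
  have hzre : |z.re| ≤ 1 / 9 := (Complex.abs_re_le_norm z).trans hr9
  have hzim : |z.im| ≤ ‖z‖ := Complex.abs_im_le_norm z
  -- ζ₁(1+z)²
  have h1z : ‖(1 : ℂ) + z‖ ≤ 5 / 4 := by
    have := norm_add_le (1 : ℂ) z; rw [norm_one] at this; linarith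
  have hζ₁ : ‖riemannZeta₁ (1 + z)‖ ≤ (13 / 4 : ℝ) ^ 4 := by
    have h := BurnolVectors.norm_riemannZeta₁_le (s := 1 + z)
      (by rw [add_re, one_re]; have := neg_abs_le z.re; linarith)
    refine h.trans ?_
    have : ‖(1 : ℂ) + z‖ + 2 ≤ 13 / 4 := by linarith
    exact pow_le_pow_left₀ (by positivity) this 4
  have hζ2 : ‖riemannZeta₁ (1 + z)‖ ^ 2 ≤ (13 / 4 : ℝ) ^ 8 := by
    calc ‖riemannZeta₁ (1 + z)‖ ^ 2 ≤ ((13 / 4 : ℝ) ^ 4) ^ 2 := pow_le_pow_left₀ (norm_nonneg _) hζ₁ 2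
      _ = (13 / 4 : ℝ) ^ 8 := by norm_num
  -- Γ(z+1)
  have hC := CΓ_pos
  have hΓ : ‖Complex.Gamma (z + 1)‖ ≤ 2 * CΓ := by
    have := norm_Gamma_strip_le (x := z.re + 1) (by have := neg_abs_le z.re; linarith)
      (by have := le_abs_self z.re; linarith) z.im
    have e : ((z.re + 1 : ℝ) : ℂ) + z.im * I = z + 1 := by
      rw [show ((z.re + 1 : ℝ) : ℂ) = (z.re : ℂ) + 1 by push_cast; ring]
      conv_rhs => rw [← Complex.re_add_im z]
      ring
    rw [e] at this
    refine this.trans ?_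
    have hy : |z.im| ≤ 1 / 9 := hzim.trans hr9
    have hE : Real.exp (-(π * |z.im| / 2)) ≤ 1 := by
      rw [Real.exp_le_one_iff]
      have := Real.pi_pos; have := abs_nonneg z.im
      nlinarith
    calc CΓ * (1 + |z.im|) ^ 3 * Real.exp (-(π * |z.im| / 2))
        ≤ CΓ * (1 + 1 / 9) ^ 3 * 1 := by gcongr
      _ ≤ 2 * CΓ := by nlinarith
  -- X^z
  have hXz : ‖(X : ℂ) ^ z‖ ≤ Real.exp (3 / 2) := by
    rw [Complex.norm_cpow_eq_rpow_re_of_pos hX0, Real.rpow_def_of_pos hX0, Real.exp_le_exp]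
    have hlogX : 0 ≤ Real.log X := Real.log_nonneg hX1
    calc Real.log X * z.re ≤ Real.log X * ‖z‖ :=
          mul_le_mul_of_nonneg_left ((le_abs_self _).trans (Complex.abs_re_le_norm z)) hlogX
      _ ≤ (6 * Lg) * (1 / (4 * Lg)) := mul_le_mul hXL hz (norm_nonneg _) (by positivity)
      _ = 3 / 2 := by field_simp; norm_num
  rw [uF, norm_mul, norm_mul, norm_pow]
  have s1 : ‖riemannZeta₁ (1 + z)‖ ^ 2 * ‖Complex.Gamma (z + 1)‖ ≤ (13 / 4 : ℝ) ^ 8 * (2 * CΓ) :=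
    mul_le_mul hζ2 hΓ (norm_nonneg _) (by positivity)
  exact mul_le_mul s1 hXz (norm_nonneg _) (by positivity)

omit [NeZero D] in
/-- **`a` near `0`**: under the same hypotheses, `‖a(z)‖ ≤ Ma` (`|φ(1+z)| ≤ 3` by
`Lemma31.norm_phi_one_add_le`). [folklore] -/
theorem norm_aF_le (hL : 3 ≤ Real.log D) (hX1 : 1 ≤ X) (hXL : Real.log X ≤ 6 * Real.log D)
    {z : ℂ} (hz : ‖z‖ ≤ 1 / (4 * Real.log D)) : ‖aF D X z‖ ≤ Ma := by
  have hL0 : 0 < Real.log D := by linarith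
  have hz1 : ‖z‖ ≤ 1 / Real.log D := by
    refine hz.trans ?_
    exact div_le_div_of_nonneg_left (by norm_num) hL0 (by linarith)
  have hz4 : ‖z‖ ≤ 1 / 4 := by
    refine hz.trans ?_
    rw [div_le_div_iff₀ (by positivity) (by norm_num)]; linarith
  have hφ := norm_phi_one_add_le (N := D) (by linarith) hz1 hz4
  rw [aF, norm_mul, Ma]
  exact mul_le_mul (norm_uF_le hL hX1 hXL hz) hφ (norm_nonneg _)
    (by have := CΓ_pos; positivity)

/-- **`k` near `0`**: for `χ` primitive mod `D`, `log D ≥ 3`, `‖z‖ ≤ 1/log D`,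
`‖k(z)‖ ≤ 2e^{9/2}(1+𝓛)𝓛` (the mean-value bound `Lemma31.norm_LFunction_one_add_sub_le` off `0`,
Cauchy's bound `Lemma31.norm_deriv_LFunction_le_near_one` at `0`). [folklore] -/
theorem norm_kF_le (hL : 3 ≤ Real.log D) (hprim : χ.IsPrimitive) {z : ℂ}
    (hz : ‖z‖ ≤ 1 / Real.log D) :
    ‖kF χ z‖ ≤ 2 * Real.exp (9 / 2) * (1 + Real.log D) * Real.log D := by
  rcases eq_or_ne z 0 with rfl | hz0
  · rw [kF_zero]
    exact norm_deriv_LFunction_le_near_one χ hL hprim (w := 1) (by simp; positivity)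
  · have h := norm_LFunction_one_add_sub_le χ hL hprim hz
    rw [LFunction_one_add_eq χ z, add_sub_cancel_left, norm_mul] at h
    have hzpos : 0 < ‖z‖ := norm_pos_iff.2 hz0
    have : ‖z‖ * ‖kF χ z‖ ≤ ‖z‖ * (2 * Real.exp (9 / 2) * (1 + Real.log D) * Real.log D) := by
      linarith
    exact le_of_mul_le_mul_left this hzpos

/-! #### §6.4 Cauchy's estimates and the residue bound -/

omit [NeZero D] in
/-- `‖(dslope a 0)′(0)‖ ≤ 2 Ma / r²`, `r = 1/(4𝓛)` (Cauchy's estimate on `|z| = r`, where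
`‖dslope a 0‖ ≤ 2Ma/r`). [folklore] -/
theorem norm_deriv_dslope_aF_le (hL : 3 ≤ Real.log D) (hX1 : 1 ≤ X)
    (hXL : Real.log X ≤ 6 * Real.log D) :
    ‖deriv (dslope (aF D X) 0) 0‖ ≤
      2 * Ma / (1 / (4 * Real.log D)) / (1 / (4 * Real.log D)) := by
  set r : ℝ := 1 / (4 * Real.log D) with hr
  have hL0 : 0 < Real.log D := by linarith
  have hr0 : 0 < r := by positivity
  have hX0 : 0 < X := by linarith
  have hr9 : r ≤ 1 / 9 := by
    rw [hr, div_le_div_iff₀ (by positivity) (by norm_num)]; linarith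
  have hd : DiffContOnCl ℂ (dslope (aF D X) 0) (ball 0 r) := by
    refine (differentiableOn_dslope_aF (N := D) hX0).diffContOnCl_ball fun z hz => ?_
    rw [mem_closedBall, dist_zero_right] at hz
    simp only [mem_setOf_eq]
    have := Complex.abs_re_le_norm z
    have := neg_abs_le z.re
    linarith
  have hM : ∀ z ∈ sphere (0 : ℂ) r, ‖dslope (aF D X) 0 z‖ ≤ 2 * Ma / r := by
    intro z hz
    rw [mem_sphere, dist_zero_right] at hz
    have hz0 : z ≠ 0 := by
      intro h; rw [h, norm_zero] at hz; exact hr0.ne' hz.symm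
    rw [dslope_of_ne _ hz0, slope_def_field, sub_zero, norm_div, hz, div_le_div_iff_of_pos_right hr0]
    have h1 := norm_aF_le (D := D) hL hX1 hXL (z := z) (by rw [hz])
    have h0 := norm_aF_le (D := D) hL hX1 hXL (z := 0) (by rw [norm_zero]; positivity)
    calc ‖aF D X z - aF D X 0‖ ≤ ‖aF D X z‖ + ‖aF D X 0‖ := norm_sub_le _ _
      _ ≤ Ma + Ma := add_le_add h1 h0
      _ = 2 * Ma := by ring
  exact Complex.norm_deriv_le_of_forall_mem_sphere_norm_le hr0 hd hM

/-- `‖(a k)′(0)‖ ≤ Ma · 2e^{9/2}(1+𝓛)𝓛 / r`, `r = 1/(4𝓛)` (Cauchy's estimate). [folklore] -/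
theorem norm_deriv_aF_mul_kF_le (hL : 3 ≤ Real.log D) (hprim : χ.IsPrimitive) (hX1 : 1 ≤ X)
    (hXL : Real.log X ≤ 6 * Real.log D) :
    ‖deriv (fun z => aF D X z * kF χ z) 0‖ ≤
      Ma * (2 * Real.exp (9 / 2) * (1 + Real.log D) * Real.log D) / (1 / (4 * Real.log D)) := by
  set r : ℝ := 1 / (4 * Real.log D) with hr
  have hL0 : 0 < Real.log D := by linarith
  have hr0 : 0 < r := by positivity
  have hX0 : 0 < X := by linarith
  have hq2 : 2 ≤ D := by
    rcases Nat.lt_or_ge D 2 with h | h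
    · interval_cases D <;> norm_num at hL
    · exact h
  have hχ1 := ne_one_of_isPrimitive χ hq2 hprim
  have hd : DiffContOnCl ℂ (fun z => aF D X z * kF χ z) (ball 0 r) := by
    refine (differentiableOn_aF_mul_kF χ hχ1 hX0).diffContOnCl_ball fun z hz => ?_
    rw [mem_closedBall, dist_zero_right] at hz
    simp only [mem_setOf_eq]
    have := Complex.abs_re_le_norm z
    have := neg_abs_le z.re
    have hr9 : r ≤ 1 / 9 := by
      rw [hr, div_le_div_iff₀ (by positivity) (by norm_num)]; linarith
    linarith
  have hM : ∀ z ∈ sphere (0 : ℂ) r, ‖aF D X z * kF χ z‖ ≤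
      Ma * (2 * Real.exp (9 / 2) * (1 + Real.log D) * Real.log D) := by
    intro z hz
    rw [mem_sphere, dist_zero_right] at hz
    have hz1 : ‖z‖ ≤ 1 / Real.log D := by
      rw [hz, hr]; exact div_le_div_of_nonneg_left (by norm_num) hL0 (by linarith)
    rw [norm_mul]
    exact mul_le_mul (norm_aF_le (D := D) hL hX1 hXL (by rw [hz])) (norm_kF_le χ hL hprim hz1)
      (norm_nonneg _) Ma_nonneg
  exact Complex.norm_deriv_le_of_forall_mem_sphere_norm_le hr0 hd hM

/-- **The residue is `φ(1) L′(1,χ)²` up to `(A)`-small terms**: for `χ` primitive mod `D`,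
`log D ≥ 3`, `1 ≤ X`, `log X ≤ 6 log D`,
`‖Res − φ(1) L′(1,χ)²‖ ≤ ‖L(1,χ)‖² · 32 Ma 𝓛² + 2‖L(1,χ)‖ · 4𝓛 · Ma · 2e^{9/2}(1+𝓛)𝓛`.
[cite: Zhang2022LandauSiegel, App. B, proof of Lemma 17.1] -/
theorem norm_residue_sub_le (hL : 3 ≤ Real.log D) (hprim : χ.IsPrimitive) (hX1 : 1 ≤ X)
    (hXL : Real.log X ≤ 6 * Real.log D) :
    ‖(Function.swap dslope (0 : ℂ))^[2] (hnum χ X) 0 - phi D 1 * deriv χ.LFunction 1 ^ 2‖ ≤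
      ‖χ.LFunction 1‖ ^ 2 * (32 * Ma * Real.log D ^ 2) +
        2 * ‖χ.LFunction 1‖ *
          (4 * Real.log D * (Ma * (2 * Real.exp (9 / 2) * (1 + Real.log D) * Real.log D))) := by
  have hL0 : 0 < Real.log D := by linarith
  have hX0 : 0 < X := by linarith
  have hq2 : 2 ≤ D := by
    rcases Nat.lt_or_ge D 2 with h | h
    · interval_cases D <;> norm_num at hL
    · exact h
  have hχ1 := ne_one_of_isPrimitive χ hq2 hprim
  rw [residue_eq χ hχ1 hX0, aF_zero_mul_kF_zero_sq, add_sub_cancel_right]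
  have h1 := norm_deriv_dslope_aF_le (D := D) hL hX1 hXL
  have h2 := norm_deriv_aF_mul_kF_le χ hL hprim hX1 hXL
  have e1 : 2 * Ma / (1 / (4 * Real.log D)) / (1 / (4 * Real.log D)) = 32 * Ma * Real.log D ^ 2 := by
    field_simp; ring
  have e2 : Ma * (2 * Real.exp (9 / 2) * (1 + Real.log D) * Real.log D) / (1 / (4 * Real.log D)) =
      4 * Real.log D * (Ma * (2 * Real.exp (9 / 2) * (1 + Real.log D) * Real.log D)) := by
    field_simp
  rw [e1] at h1
  rw [e2] at h2
  refine (norm_add_le _ _).trans (add_le_add ?_ ?_)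
  · rw [norm_mul, norm_pow]
    exact mul_le_mul_of_nonneg_left h1 (by positivity)
  · rw [norm_mul, norm_mul, Complex.norm_ofNat]
    exact mul_le_mul_of_nonneg_left h2 (by positivity)

end Residue

/-! ### §7. `φ(1) L′(1,χ)² = 𝔞` -/

section FrakA

omit [NeZero D] in
/-- **`φ(1) = (6/π²) ∏_{p∣D} p/(p+1)`** (`ζ(2) = π²/6`, Mathlib's `riemannZeta_two`; the source's
"`∏_p(1−p^{-2}) ∏_{p∣D}(1−p^{-1})(1−p^{-2})^{-1}`"). [cite: Zhang2022LandauSiegel, App. B, proof of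
Lemma 17.1] -/
theorem phi_one_eq : phi D 1 = 6 / (π : ℂ) ^ 2 * ∏ p ∈ D.primeFactors, ((p : ℂ) / (p + 1)) := by
  rw [phi_def, mul_one, riemannZeta_two, mul_inv, ← Finset.prod_inv_distrib]
  have hπ : (π : ℂ) ≠ 0 := ofReal_ne_zero.2 Real.pi_pos.ne'
  congr 1
  · field_simp
  · refine Finset.prod_congr rfl fun p hp => ?_
    have hp := Nat.prime_of_mem_primeFactors hp
    have hp0 : (p : ℂ) ≠ 0 := by exact_mod_cast hp.ne_zero
    have hp1 : (p : ℂ) + 1 ≠ 0 := by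
      intro h
      have := congrArg Complex.re h
      simp at this
      linarith [(Nat.cast_nonneg p : (0 : ℝ) ≤ p)]
    rw [cpow_neg_one]
    field_simp

/-- `φ(1) L′(1,χ)² = 𝔞` (complex form). [cite: Zhang2022LandauSiegel, §2 (2.31)] -/
theorem phi_one_mul_deriv_sq : phi D 1 * deriv χ.LFunction 1 ^ 2 = frakAC χ := by
  rw [phi_one_eq, frakAC]; ring

/-- `L′(1,χ)` is real for a quadratic `χ ≠ 1` (the tree's
`ExceptionalZero.deriv_LFunction_ofReal_im_eq_zero`). [folklore] -/
theorem deriv_LFunction_one_im (hχ1 : χ ≠ 1) (hχ : χ ^ 2 = 1) :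
    (deriv χ.LFunction 1).im = 0 := by
  have h := ExceptionalZero.deriv_LFunction_ofReal_im_eq_zero χ hχ1 hχ (σ := 1) one_pos
  rwa [Complex.ofReal_one] at h

/-- The complex and real forms of `𝔞` agree for a quadratic `χ ≠ 1`.
[cite: Zhang2022LandauSiegel, §2 (2.31)] -/
theorem frakAC_eq (hχ1 : χ ≠ 1) (hχ : χ ^ 2 = 1) : frakAC χ = (frakA χ : ℂ) := by
  have him := deriv_LFunction_one_im χ hχ1 hχ
  have hre : deriv χ.LFunction 1 = ((deriv χ.LFunction 1).re : ℂ) := by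
    apply Complex.ext <;> simp [him]
  rw [frakAC, hre, frakA]
  push_cast
  ring

end FrakA

/-! ### §8. The explicit formula for `W_{ν²}(X)` and the assembly -/

section Assembly

/-- **The explicit formula**: for `χ` quadratic, `χ ≠ 1`, `X > 0`,
`2π W_{ν²}(X) = 2π · Res_{z=0} F + ∫ F(−1/4+iy) dy`, the residue of the triple pole written as
`((swap dslope 0)^[2] h)(0)` (the tree's strip theorem
`Literature.Analysis.Complex.integral_vertical_sub_eq_sum_of_poles_dslope`).
[cite: Zhang2022LandauSiegel, App. B, proof of Lemma 17.1] -/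
theorem W_eq_residue_add (hχ : χ ^ 2 = 1) (hχ1 : χ ≠ 1) (hX : 0 < X) :
    2 * (π : ℂ) * W (fun n => divisorSumChar χ n ^ 2) X =
      2 * π * (Function.swap dslope (0 : ℂ))^[2] (hnum χ X) 0 +
        ∫ t : ℝ, Fint χ X ((((-(1 / 4) : ℝ)) : ℂ) + t * I) := by
  set U : Set ℂ := {z : ℂ | -(1 / 2) < z.re} with hU
  have hUo : IsOpen U := isOpen_U
  have hstrip := Literature.Analysis.Complex.integral_vertical_sub_eq_sum_of_poles_dslope
    (F := Fint χ X) (σ₁ := -(1 / 4)) (κ := 2) (by norm_num) ({0} : Finset ℂ) (fun _ => 2)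
    (fun _ => hnum χ X) U hUo
    (fun z hz => by
      simp only [mem_preimage, mem_Icc] at hz
      show -(1 / 2) < z.re
      linarith [hz.1])
    (fun p hp => by rw [Finset.mem_singleton] at hp; rw [hp]; simp)
    (by rw [Finset.coe_singleton]; exact differentiableOn_Fint χ hχ1 hX)
    (fun p hp => by
      rw [Finset.mem_singleton] at hp
      subst hp
      refine ⟨U, hUo.mem_nhds (by simp [hU]), differentiableOn_hnum χ hχ1 hX,
        fun z hz hz0 => ?_⟩
      refine Fint_eq_hnum_div χ hz0 fun m hm => ?_
      have hzre : -(1 / 2) < z.re := hz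
      rw [hm] at hzre hz0
      simp at hzre
      have : m = 0 := by
        by_contra h
        have : (1 : ℝ) ≤ m := by exact_mod_cast Nat.one_le_iff_ne_zero.2 h
        linarith
      subst this
      simp at hz0)
    (integrable_Fint_line χ hχ1 hX (Or.inr rfl))
    (integrable_Fint_line χ hχ1 hX (Or.inl rfl))
    (Fint_horizontal_decay χ hχ1 hX)
  rw [Finset.sum_singleton] at hstrip
  have h2 := (integral_Fint_line_two χ hχ hX).2
  have e2 : (∫ t : ℝ, Fint χ X (((2 : ℝ) : ℂ) + t * I)) = ∫ t : ℝ, Fint χ X (2 + t * I) := by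
    norm_num
  rw [e2, h2] at hstrip
  exact sub_eq_iff_eq_add.1 hstrip

/-- **Zhang (2022), Lemma 17.1** [cite: Zhang2022LandauSiegel, §17, Lemma 17.1; App. B]
("Lemma 17.1. We have `∑_{n<D⁴} ν(n)²/n = 𝔞 + o(1)`", under the standing assumption (A) of the
source), kernel-checked with an explicit rate and threshold: there is an absolute constant `C` such
that for every `D` with `log D ≥ 3` and every PRIMITIVE Dirichlet character `χ` mod `D` with `χ² = 1`
satisfying (A) `‖L(1,χ)‖ ≤ (log D)^{-2022}`,

  `|∑_{n<D⁴} |ν(n)|²/n − 𝔞| ≤ C (log D)^{-2011}`,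

where `ν(n) = ∑_{d∣n} χ(d)` (so `ν(n)² = |ν(n)|²`), `𝔞 = (6/π²) L′(1,χ)² ∏_{q∣D} q/(q+1)` ((2.31),
`frakA`), and the sum is over `0 ≤ n < D⁴` (the term `n = 0` vanishes). -/
theorem lemma_17_1 : ∃ C : ℝ, ∀ (D : ℕ) [NeZero D] (χ : DirichletCharacter ℂ D),
    χ.IsPrimitive → χ ^ 2 = 1 → 3 ≤ Real.log D →
    ‖χ.LFunction 1‖ ≤ 1 / Real.log D ^ 2022 →
      |∑ n ∈ Finset.range (D ^ 4), ‖divisorSumChar χ n‖ ^ 2 / n - frakA χ| ≤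
        C / Real.log D ^ 2011 := by
  obtain ⟨C31, hC31⟩ := Lemma31.lemma_3_1
  obtain ⟨Cd, hCd1, hCd⟩ := Sieve.exists_card_divisors_le_mul_rpow' (by norm_num : (0 : ℝ) < 1 / 8)
  refine ⟨C31 + 1154 * Cd ^ 2 * (8 * 4028 ^ 2014) + (32 * Ma + 32 * Real.exp (9 / 2) * Ma) +
    2 * 28 ^ 13 * Kline17 * Cd ^ 2 * (8 * 4028 ^ 2014), ?_⟩
  intro D _ χ hprim hχ2 hL hA
  set M : ℝ := (4028 : ℝ) ^ 2014 with hM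
  clear_value M
  set M' : ℝ := (28 : ℝ) ^ 13 with hM'
  clear_value M'
  set Lg : ℝ := Real.log D with hLdef
  have hL1 : 1 ≤ Lg := by linarith
  have hL0 : 0 < Lg := by linarith
  have hD0 : D ≠ 0 := by
    rintro rfl; simp [hLdef] at hL; linarith
  have hDpos : (0 : ℝ) < D := by exact_mod_cast Nat.pos_of_ne_zero hD0
  have hD8 : 8 ≤ D := by
    have h1 : Real.exp 3 ≤ Real.exp Lg := Real.exp_le_exp.2 hL
    rw [hLdef, Real.exp_log hDpos] at h1
    have := eight_lt_exp_three
    exact_mod_cast (show (8 : ℝ) ≤ D by linarith)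
  have hD1 : (1 : ℝ) ≤ D := by exact_mod_cast Nat.one_le_iff_ne_zero.2 hD0
  have hχ1 := ne_one_of_isPrimitive χ (by omega) hprim
  -- the parameter `X = D⁶`
  set X : ℝ := (D : ℝ) ^ 6 with hXdef
  have hXpos : 0 < X := by positivity
  have hX1 : 1 ≤ X := one_le_pow₀ hD1
  have hXL : Real.log X ≤ 6 * Real.log D := by rw [hXdef, Real.log_pow]; push_cast; exact le_rfl
  -- `1/D ≤ (1+𝓛)³/D^{1/2} ≤ 8M/𝓛^{2011}`
  have hlp := aux_logpow (D := D) hL1 hDpos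
  rw [← hLdef, ← hM] at hlp
  have hDhalf : 0 < (D : ℝ) ^ (1 / 2 : ℝ) := by positivity
  have hinvD : 1 / (D : ℝ) ≤ 8 * M / Lg ^ 2011 := by
    refine le_trans ?_ hlp
    rw [div_le_div_iff₀ hDpos hDhalf, one_mul]
    have h3 : (1 : ℝ) ≤ (1 + Lg) ^ 3 := one_le_pow₀ (by linarith)
    have hh : (D : ℝ) ^ (1 / 2 : ℝ) ≤ D := by
      calc (D : ℝ) ^ (1 / 2 : ℝ) ≤ (D : ℝ) ^ (1 : ℝ) :=
            Real.rpow_le_rpow_of_exponent_le hD1 (by norm_num)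
        _ = D := Real.rpow_one _
    nlinarith
  -- (1) smoothing
  have hS := abs_sum_sub_W_re_le χ hχ2 hCd hD1
  have h31 : ∑ n ∈ Finset.Ioc (D ^ 4) (D ^ 8), ‖divisorSumChar χ n‖ ^ 2 / n ≤ C31 / Lg ^ 2011 := by
    refine hC31 D χ hprim hχ2 hL hA (D ^ 8) ?_
    push_cast
    rw [← Real.exp_log (pow_pos hDpos 8), Real.exp_le_exp, Real.log_pow, ← hLdef]
    push_cast
    have h8 : (4 : ℝ) ≤ Lg ^ 8 := by
      calc (4 : ℝ) ≤ 3 ^ 8 := by norm_num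
        _ ≤ Lg ^ 8 := pow_le_pow_left₀ (by norm_num) hL 8
    nlinarith
  have hT1 : |∑ n ∈ Finset.range (D ^ 4), ‖divisorSumChar χ n‖ ^ 2 / n -
      (W (fun n => divisorSumChar χ n ^ 2) X).re| ≤
      C31 / Lg ^ 2011 + 1154 * Cd ^ 2 * (8 * M) / Lg ^ 2011 := by
    refine hS.trans (add_le_add h31 ?_)
    have hCd0 : 0 ≤ 1154 * Cd ^ 2 := by positivity
    calc 1154 * Cd ^ 2 / (D : ℝ) = 1154 * Cd ^ 2 * (1 / D) := by ring
      _ ≤ 1154 * Cd ^ 2 * (8 * M / Lg ^ 2011) := mul_le_mul_of_nonneg_left hinvD hCd0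
      _ = 1154 * Cd ^ 2 * (8 * M) / Lg ^ 2011 := by ring
  -- (2) the explicit formula `W = Res + (1/2π) ∫`
  have hW := W_eq_residue_add χ hχ2 hχ1 hXpos
  set Res : ℂ := (Function.swap dslope (0 : ℂ))^[2] (hnum χ X) 0 with hRes
  set Iline : ℂ := ∫ t : ℝ, Fint χ X ((((-(1 / 4) : ℝ)) : ℂ) + t * I) with hIline
  have hπ0 : (π : ℂ) ≠ 0 := ofReal_ne_zero.2 Real.pi_pos.ne'
  have hWeq : W (fun n => divisorSumChar χ n ^ 2) X = Res + (1 / (2 * π)) * Iline := by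
    field_simp
    linear_combination hW
  -- (3) the residue is `𝔞` up to `O(𝓛^{-2011})`
  have hres := norm_residue_sub_le χ hL hprim hX1 hXL
  rw [← hRes, phi_one_mul_deriv_sq, ← hLdef] at hres
  have hE := Real.exp_pos (9 / 2)
  have hMa := Ma_nonneg
  have hT2 : ‖Res - frakAC χ‖ ≤ (32 * Ma + 32 * Real.exp (9 / 2) * Ma) / Lg ^ 2011 := by
    refine hres.trans ?_
    have hA2 : ‖χ.LFunction 1‖ ^ 2 ≤ (1 / Lg ^ 2022) ^ 2 := pow_le_pow_left₀ (norm_nonneg _) hA 2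
    have p1 : ‖χ.LFunction 1‖ ^ 2 * (32 * Ma * Lg ^ 2) ≤ 32 * Ma / Lg ^ 2011 := by
      calc ‖χ.LFunction 1‖ ^ 2 * (32 * Ma * Lg ^ 2) ≤ (1 / Lg ^ 2022) ^ 2 * (32 * Ma * Lg ^ 2) :=
            mul_le_mul_of_nonneg_right hA2 (by positivity)
        _ = 32 * Ma / Lg ^ 2011 * (1 / Lg ^ 2031) := by field_simp
        _ ≤ 32 * Ma / Lg ^ 2011 * 1 := by
            gcongr
            rw [div_le_one (by positivity)]; exact one_le_pow₀ hL1
        _ = 32 * Ma / Lg ^ 2011 := by ring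
    have p2 : 2 * ‖χ.LFunction 1‖ *
        (4 * Lg * (Ma * (2 * Real.exp (9 / 2) * (1 + Lg) * Lg))) ≤
        32 * Real.exp (9 / 2) * Ma / Lg ^ 2011 := by
      have h1L : 1 + Lg ≤ 2 * Lg := by linarith
      calc 2 * ‖χ.LFunction 1‖ * (4 * Lg * (Ma * (2 * Real.exp (9 / 2) * (1 + Lg) * Lg)))
          ≤ 2 * (1 / Lg ^ 2022) * (4 * Lg * (Ma * (2 * Real.exp (9 / 2) * (2 * Lg) * Lg))) := by
            gcongr
        _ = 32 * Real.exp (9 / 2) * Ma / Lg ^ 2011 * (1 / Lg ^ 8) := by field_simp; ring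
        _ ≤ 32 * Real.exp (9 / 2) * Ma / Lg ^ 2011 * 1 := by
            gcongr
            rw [div_le_one (by positivity)]; exact one_le_pow₀ hL1
        _ = 32 * Real.exp (9 / 2) * Ma / Lg ^ 2011 := by ring
    rw [add_div]
    exact add_le_add p1 p2
  -- (4) the shifted integral
  have hT3 : ‖(1 / (2 * (π : ℂ))) * Iline‖ ≤ 2 * M' * Kline17 * Cd ^ 2 * (8 * M) / Lg ^ 2011 := by
    rw [norm_mul]
    have hπ1 : ‖(1 / (2 * (π : ℂ)))‖ ≤ 1 := by
      rw [norm_div, norm_one, norm_mul, Complex.norm_ofNat, Complex.norm_real, Real.norm_eq_abs,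
        abs_of_pos Real.pi_pos, div_le_one (by positivity)]
      linarith [Real.pi_gt_three]
    have hI := norm_integral_Fint_line_le χ hprim hD8 hXpos
    rw [← hIline, ← hM', ← hLdef] at hI
    -- the `D`-bookkeeping: `t = D^{1/8}`
    set t : ℝ := (D : ℝ) ^ (1 / 8 : ℝ) with htdef
    have ht0 : 0 < t := by positivity
    have ht2 : (D : ℝ) ^ (1 / 4 : ℝ) = t ^ 2 := by
      rw [htdef, ← Real.rpow_natCast, ← Real.rpow_mul hDpos.le]; norm_num
    have ht4 : (D : ℝ) ^ (1 / 2 : ℝ) = t ^ 4 := by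
      rw [htdef, ← Real.rpow_natCast, ← Real.rpow_mul hDpos.le]; norm_num
    have ht8 : (D : ℝ) = t ^ 8 := by
      rw [htdef, ← Real.rpow_natCast, ← Real.rpow_mul hDpos.le]; norm_num
    have hX4 : X ^ (-(1 / 4) : ℝ) = 1 / t ^ 12 := by
      have e12 : (1 : ℝ) / t ^ 12 = t ^ (-(12 : ℝ)) := by
        rw [Real.rpow_neg ht0.le, ← Real.rpow_natCast t 12, one_div]; norm_num
      rw [e12, hXdef, ht8, ← pow_mul, ← Real.rpow_natCast, ← Real.rpow_mul ht0.le]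
      norm_num
    have hτ : (D.divisors.card : ℝ) ≤ Cd * t := hCd D
    have hτ2 : (D.divisors.card : ℝ) ^ 2 ≤ (Cd * t) ^ 2 := pow_le_pow_left₀ (Nat.cast_nonneg _) hτ 2
    rw [ht4] at hlp
    have hK := Kline17_pos
    have hM'0 : 0 ≤ M' := by rw [hM']; positivity
    have ht1 : 1 ≤ t := by rw [htdef]; exact Real.one_le_rpow hD1 (by norm_num)
    have h8M : 0 ≤ 8 * M / Lg ^ 2011 := by rw [hM]; positivity
    have h1t : 1 / t ^ 4 ≤ 1 := by
      rw [div_le_one (by positivity)]; exact one_le_pow₀ ht1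
    have hmain : Kline17 * (D.divisors.card : ℝ) ^ 2 * (D : ℝ) ^ (1 / 4 : ℝ) * (1 + Lg) ^ 3 *
        X ^ (-(1 / 4) : ℝ) ≤ Kline17 * Cd ^ 2 * (8 * M / Lg ^ 2011) := by
      calc Kline17 * (D.divisors.card : ℝ) ^ 2 * (D : ℝ) ^ (1 / 4 : ℝ) * (1 + Lg) ^ 3 *
            X ^ (-(1 / 4) : ℝ)
          ≤ Kline17 * (Cd * t) ^ 2 * t ^ 2 * (1 + Lg) ^ 3 * (1 / t ^ 12) := by
            rw [ht2, hX4]; gcongr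
        _ = Kline17 * Cd ^ 2 * ((1 + Lg) ^ 3 / t ^ 4 * (1 / t ^ 4)) := by
            field_simp
        _ ≤ Kline17 * Cd ^ 2 * (8 * M / Lg ^ 2011 * 1) := by
            refine mul_le_mul_of_nonneg_left ?_ (by positivity)
            exact mul_le_mul hlp h1t (by positivity) h8M
        _ = Kline17 * Cd ^ 2 * (8 * M / Lg ^ 2011) := by ring
    calc ‖(1 / (2 * (π : ℂ)))‖ * ‖Iline‖
        ≤ 1 * (2 * M' * (Kline17 * (D.divisors.card : ℝ) ^ 2 * (D : ℝ) ^ (1 / 4 : ℝ) *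
            (1 + Lg) ^ 3 * X ^ (-(1 / 4) : ℝ))) :=
          mul_le_mul hπ1 hI (norm_nonneg _) (by norm_num)
      _ ≤ 1 * (2 * M' * (Kline17 * Cd ^ 2 * (8 * M / Lg ^ 2011))) := by gcongr
      _ = 2 * M' * Kline17 * Cd ^ 2 * (8 * M) / Lg ^ 2011 := by ring
  -- (5) combine
  have hAC := frakAC_eq χ hχ1 hχ2
  have hWn : ‖W (fun n => divisorSumChar χ n ^ 2) X - (frakA χ : ℂ)‖ ≤
      (32 * Ma + 32 * Real.exp (9 / 2) * Ma) / Lg ^ 2011 +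
        2 * M' * Kline17 * Cd ^ 2 * (8 * M) / Lg ^ 2011 := by
    rw [hWeq, ← hAC, show Res + 1 / (2 * (π : ℂ)) * Iline - frakAC χ =
      (Res - frakAC χ) + 1 / (2 * (π : ℂ)) * Iline by ring]
    exact (norm_add_le _ _).trans (add_le_add hT2 hT3)
  have hre : |(W (fun n => divisorSumChar χ n ^ 2) X).re - frakA χ| ≤
      ‖W (fun n => divisorSumChar χ n ^ 2) X - (frakA χ : ℂ)‖ := by
    have := Complex.abs_re_le_norm (W (fun n => divisorSumChar χ n ^ 2) X - (frakA χ : ℂ))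
    simpa using this
  set S : ℝ := ∑ n ∈ Finset.range (D ^ 4), ‖divisorSumChar χ n‖ ^ 2 / n
  set Wr : ℝ := (W (fun n => divisorSumChar χ n ^ 2) X).re
  calc |S - frakA χ| = |(S - Wr) + (Wr - frakA χ)| := by ring_nf
    _ ≤ |S - Wr| + |Wr - frakA χ| := abs_add_le _ _
    _ ≤ (C31 / Lg ^ 2011 + 1154 * Cd ^ 2 * (8 * M) / Lg ^ 2011) +
        ((32 * Ma + 32 * Real.exp (9 / 2) * Ma) / Lg ^ 2011 +
          2 * M' * Kline17 * Cd ^ 2 * (8 * M) / Lg ^ 2011) := add_le_add hT1 (hre.trans hWn)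
    _ = _ := by rw [hLdef]; ring

/-- The same with the complex `ν(n)²` and the complex constant of the source
(`ν(n)² = |ν(n)|²` and `L′(1,χ) ∈ ℝ` for a quadratic `χ`):
`‖∑_{n<D⁴} ν(n)²/n − (6/π²)L′(1,χ)²∏_{q∣D} q/(q+1)‖ ≤ C 𝓛^{-2011}`.
[cite: Zhang2022LandauSiegel, §17, Lemma 17.1] -/
theorem lemma_17_1_complex : ∃ C : ℝ, ∀ (D : ℕ) [NeZero D] (χ : DirichletCharacter ℂ D),
    χ.IsPrimitive → χ ^ 2 = 1 → 3 ≤ Real.log D →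
    ‖χ.LFunction 1‖ ≤ 1 / Real.log D ^ 2022 →
      ‖∑ n ∈ Finset.range (D ^ 4), divisorSumChar χ n ^ 2 / (n : ℂ) - frakAC χ‖ ≤
        C / Real.log D ^ 2011 := by
  obtain ⟨C, hC⟩ := lemma_17_1
  refine ⟨C, fun D _ χ hprim hχ2 hL hA => ?_⟩
  have h := hC D χ hprim hχ2 hL hA
  have hq2 : 2 ≤ D := by
    rcases Nat.lt_or_ge D 2 with h' | h'
    · interval_cases D <;> norm_num at hL
    · exact h'
  have hχ1 := ne_one_of_isPrimitive χ hq2 hprim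
  have hsum : ∑ n ∈ Finset.range (D ^ 4), divisorSumChar χ n ^ 2 / (n : ℂ) =
      ((∑ n ∈ Finset.range (D ^ 4), ‖divisorSumChar χ n‖ ^ 2 / n : ℝ) : ℂ) := by
    push_cast
    refine Finset.sum_congr rfl fun n _ => ?_
    rw [divisorSumChar_sq_eq χ hχ2 n]
    push_cast
    rfl
  rw [hsum, frakAC_eq χ hχ1 hχ2, ← ofReal_sub, Complex.norm_real, Real.norm_eq_abs]
  exact h

end Assembly

end Literature.NumberTheory.LFunctions.Zhang2022.Lemma171

end
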